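import Literature.NumberTheory.EllipticCurves.LeadingTermBSZOrdDensityProofs
import Literature.NumberTheory.EllipticCurves.LeadingTermBSZAssemblyProofs
import Mathlib.NumberTheory.Padics.PadicVal.Basic
import HarnessLib

/-!
# Bhargava–Skinner–Zhang, display (2): `μ(S₁'(5)) - μ(S₁(5)) ≤ 10⁻⁵` (proved)

`Proofs` companion of `Literature/NumberTheory/EllipticCurves/LeadingTerm.lean` (bsd.S27,
`Literature.NumberTheory.EllipticCurves.bhargava_skinner_zhang`), continuing
`LeadingTermBSZLocalDensityProofs` (the one-prime local-density formula `hasHeightDensity_residues`),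
`LeadingTermBSZResidueCountProofs` (the disc bijection `B ↦ 4A³ + 27B²`) and
`LeadingTermBSZOrdDensityProofs` (Lemma 19, first display). Source: M. Bhargava, C. Skinner, W. Zhang,
*A majority of elliptic curves over `ℚ` satisfy the Birch and Swinnerton-Dyer conjecture*,
arXiv:1407.1826 (2014), §3.1–3.2 (pp. 8–10):

> "let `S₁(p)` be the subset of curves `E_{A,B} ∈ S₁'(p)` also satisfying:
> `p ∤ ord_ℓ(Δ(A,B))` for all primes `ℓ ≡ ±1 (mod p)` such that `ord_ℓ(Δ(A,B)) > 0`." …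
> "**Lemma 19.** We have `μ(S₁(5)) > .7917957`. *Proof.* The density of `S₁(p)` equals the density of
> `S₁'(p)` times the product over all primes `ℓ ≡ ±1 (mod p)` of the local densities `μ_ℓ(Σ_ℓ)` where
> `Σ_ℓ` is the set of `(A,B) ∈ ℤ_ℓ²` such that `p ∤ ord_ℓ(Δ(A,B))` whenever `ℓ ∣ Δ(A,B)`. We note that for
> a prime `ℓ ≥ 5`, the measure of the set of `(A,B) ∈ ℤ_ℓ²` that satisfy `ℓ ∤ A` and `ord_ℓ(Δ(A,B)) = k`
> for a given integer `k > 0` is `(ℓ-1)²/ℓ^{k+2}`. … It follows that for any prime `ℓ ≡ ±1 (mod p)`,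
> `μ_ℓ(Σ_ℓ)` is at least `(1-ℓ⁻¹⁰)⁻¹(1 - Σ_{n≥1} (ℓ-1)²/ℓ^{5n+2} - ℓ⁻⁵)` … The second term being
> subtracted is the measure of the set of `(A,B)` such that `ℓ² ∣ A` and `ℓ³ ∣ B`, which contains …
> those `(A,B)` such that `ℓ ∣ A`, `ord_ℓ(Δ(A,B)) > 0`, and `5 ∣ ord_ℓ(Δ(A,B))`. Therefore
> `μ(S₁(5)) ≥ μ(S₁'(5))·∏_{ℓ ≡ ±1 (mod 5)} (…) = .7917957…`. In particular, we note that
> (5) `μ(S₁'(5)) - μ(S₁(5)) ≤ .00001`."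

Display (5) is the only form in which Lemma 19 enters the proofs of Cor 24 and Cor 26 (the constants
`20.68%` and `66.48%`): it is hypothesis `hν` of the tree's assembly
`Literature.NumberTheory.EllipticCurves.heightDensityGE_satisfiesBSDRankLeOne_of_pieces`
(`LeadingTermBSZAssemblyProofs`), "the members of `T = S₀(5) ∩ S₁'(5)` outside `S₁` have upper
density `≤ 10⁻⁵`". This file PROVES it unconditionally:

* `Literature.NumberTheory.EllipticCurves.bsz_mu_diff` — for every `η > 0`, eventually at most
  `(10⁻⁵ + η)·#{E_{A,B} : H < X}` curves of naive height `< X` admit a prime `ℓ ≡ ±1 (mod 5)` with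
  `ℓ ∣ 4A³ + 27B²` and `5 ∣ ord_ℓ(4A³ + 27B²)` (`ord_ℓ Δ(A,B) = ord_ℓ(4A³+27B²)` for odd `ℓ`, as
  `Δ = -16(4A³+27B²)`);
* `Literature.NumberTheory.EllipticCurves.bsz_mu_diff_inter_le` — the same intersected with any
  predicate `T`, literally hypothesis `hν` of the assembly with
  `S₁(A,B) :⟺ ∀ ℓ prime, ℓ ≡ ±1 (mod 5), ℓ ∣ 4A³+27B² → 5 ∤ ord_ℓ(4A³+27B²)`.

## The proof, and where it deviates from the source

The source derives (5) from the exact density of `S₁(5)`, i.e. from the product formula for the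
density of a large family defined by congruence conditions at infinitely many primes ([BS2],
Bhargava–Shankar's uniformity estimate). For the DIFFERENCE (5) a union bound over the primes
`ℓ ≡ ±1 (mod 5)` suffices and is elementary, because `ℓ ∣ Δ`, `5 ∣ ord_ℓ Δ` forces `ℓ⁵ ∣ 4A³ + 27B²`:

1. (`BSZMuDiff.trichotomy`, §A) at a prime `ℓ ≥ 5` such a pair has `ℓ ∤ A`, `ℓ⁵ ∣ 4A³+27B²`; or
   `ℓ³ ∣ A`, `ℓ⁵ ∣ B`; or `A = ℓ²a`, `B = ℓ³b`, `ℓ ∤ a`, `ℓ⁴ ∣ 4a³+27b²` (the source's remark that the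
   pairs with `ℓ ∣ A` lie in `{ℓ² ∣ A, ℓ³ ∣ B}`, `BSZMuDiff.sq_dvd_and_cube_dvd`, sharpened using
   `ord_ℓ ≥ 10`);
2. (`BSZMuDiff.hasHeightDensity_not_dvd_and_pow_dvd_disc`, §D) `{ℓ ∤ A, ℓ^{k+2} ∣ 4A³+27B²}` has
   height density exactly `(ℓ-1)/ℓ^{k+3}·(1-ℓ⁻¹⁰)⁻¹` — the sum over `j ≥ k+2` of the printed measures
   `(ℓ-1)²/ℓ^{j+2}` — by the residue count "two classes of `B` modulo `ℓ^{k+2}` for each of the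
   `(ℓ-1)/2·ℓ^{k+1}` admissible `A`" (`BSZMuDiff.card_pairs_zero`, from `bsz_lemma18_card_residues_eq`
   and `BSZLemma19.card_admissible`) and `hasHeightDensity_residues`;
3. (§B, §C, §G) the two pieces with `ℓ ∣ A` have upper densities `≤ 2/ℓ⁸` and `≤ 4/ℓ⁹` by direct box
   counts (at most two square roots of `-4a³/27` modulo `ℓⁿ` for `ℓ ∤ a`, `BSZMuDiff.card_roots_le_two`,
   hence `≤ 2(2R/ℓⁿ + 2)` values of `b`, `|b| < R`, with `ℓⁿ ∣ 4a³ + 27b²`,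
   `BSZMuDiff.card_filter_pow_dvd_disc_le`), divided by `#{H < X} ~ 4R₁R₂∏_p(1-p⁻¹⁰)`
   (`card_heightFamilyBelow_asymptotic_holds`, `∏_p (1-p⁻¹⁰) ≥ 1/2`; `BSZMuDiff.eventually_le_of_box_bound`);
4. (§F) the primes `ℓ > Y` contribute together at most `3R₁R₂/Y⁴ + ⌊(2X)^{1/5}⌋(10R₁ + 6R₂ + 5)`
   pairs of height `< X` (`BSZMuDiff.card_tail_le`: `ℓ⁵ ≤ |4A³+27B²| < 2X`, the same two-roots count
   at each `ℓ`, and `Σ_{ℓ > Y} ℓ⁻⁵ ≤ 1/(4Y⁴)`), i.e. upper density `≤ 3/(2Y⁴)`;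
5. (§H) with `Y = 40` the primes `≡ ±1 (mod 5)` below `Y` are `11, 19, 29, 31`, and
   `Σ_{ℓ ∈ {11,19,29,31}} ((ℓ-1)/(ℓ⁶(1-ℓ⁻¹⁰)) + 2/ℓ⁸ + 4/ℓ⁹) + 3/(2·40⁴) = 6.7·10⁻⁶ ≤ 10⁻⁵`
   (`norm_num`). (Along the source's route the bound is `μ(S₁'(5))(1 - .9999877…) ≈ 9.7·10⁻⁶`; with the
   corrected `μ(S₁'(5)) = .7838…` of the caveat in `bhargava_skinner_zhang`'s docstring, `9.6·10⁻⁶`.)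

No definitions and no named facts are introduced (D-0026); everything is a theorem.

Remark on the source (recorded for the formalization of Lemma 20, hypothesis `hW` of the assembly;
not used here). In the proof of Lemma 20 the sets `S(L,ℓ)` ("`ord_ℓ(Δ(A,B)) ≤ 1` and `ord_q(Δ) ≠ 1`
for all `5 ≤ q ≤ L`, `q ∉ {ℓ,p}`") are not disjoint (they share the curves with no `q ≤ L` of
`ord_q Δ = 1`), and the displayed expression
`Σ_{5≤ℓ≤L} (1-ℓ⁻¹⁰)⁻¹(1 - ℓ⁻² - (ℓ-1)/ℓ³) ∏_{q ≠ ℓ} (1-q⁻¹⁰)⁻¹(1 - (q-1)²/q³)` does not tend to `0`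
(it is `≍ L/log²L`: `1.67` at `L = 10`, `10.3` at `L = 100`, `1.2·10⁴` at `L = 10⁶`); the argument goes
through with `ord_ℓ(Δ) = 1` in the definition of `S(L,ℓ)` (local factor `(ℓ-1)²/ℓ³`) together with the
set of curves having no `5 ≤ q ≤ L` with `ord_q Δ = 1` (density `∏_q (1 - (q-1)²/q³)(1-q⁻¹⁰)⁻¹ → 0`).

## References

* M. Bhargava, C. Skinner, W. Zhang, arXiv:1407.1826 (2014), §3.1 (definition of `S₁(p)`), Lemma 19
  and display (2). [cite: BhargavaSkinnerZhang2014, Lemma 19 and display (2)]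
* M. Bhargava, A. Shankar, Ann. of Math. (2) 181 (2015) 191–242, Lemma 5.15 (the count of the height
  family used for the normalisation). [cite: BhargavaShankarAnnals2015, Lemma 5.15]
-/

noncomputable section

open scoped Classical
open Filter Topology

namespace Literature.NumberTheory.EllipticCurves

namespace BSZMuDiff

open HeightCount

/-! ### §A Divisibility at a prime `ℓ ≥ 5` -/

/-- A prime `ℓ ≥ 5` dividing `27m` divides `m`. [folklore] -/
theorem dvd_of_dvd_mul_27 {ℓ : ℕ} (hℓ : ℓ.Prime) (h5 : 5 ≤ ℓ) {m : ℤ} (h : (ℓ : ℤ) ∣ 27 * m) :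
    (ℓ : ℤ) ∣ m := by
  have hp : Prime (ℓ : ℤ) := Nat.prime_iff_prime_int.mp hℓ
  rcases hp.dvd_or_dvd h with h27 | hm
  · exfalso
    have h3 : (ℓ : ℤ) ∣ (3 : ℤ) ^ 3 := by rwa [show ((3 : ℤ) ^ 3) = 27 by norm_num]
    have h3' : (ℓ : ℤ) ≤ 3 := Int.le_of_dvd (by norm_num) (hp.dvd_of_dvd_pow h3)
    omega
  · exact hm

/-- A prime `ℓ ≥ 5` dividing `4m` divides `m`. [folklore] -/
theorem dvd_of_dvd_mul_4 {ℓ : ℕ} (hℓ : ℓ.Prime) (h5 : 5 ≤ ℓ) {m : ℤ} (h : (ℓ : ℤ) ∣ 4 * m) :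
    (ℓ : ℤ) ∣ m := by
  have hp : Prime (ℓ : ℤ) := Nat.prime_iff_prime_int.mp hℓ
  rcases hp.dvd_or_dvd h with h4 | hm
  · exfalso
    have h2 : (ℓ : ℤ) ∣ (2 : ℤ) ^ 2 := by rwa [show ((2 : ℤ) ^ 2) = 4 by norm_num]
    have h2' : (ℓ : ℤ) ≤ 2 := Int.le_of_dvd (by norm_num) (hp.dvd_of_dvd_pow h2)
    omega
  · exact hm

/-- **`ℓ ∣ A` and `ℓ⁵ ∣ 4A³ + 27B²` force `ℓ² ∣ A` and `ℓ³ ∣ B`** (`ℓ ≥ 5` prime; the source, proof of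
Lemma 19: "the set of `(A,B)` such that `ℓ² ∣ A` and `ℓ³ ∣ B` … contains … those `(A,B)` such that
`ℓ ∣ A`, `ord_ℓ(Δ(A,B)) > 0`, and `5 ∣ ord_ℓ(Δ(A,B))`"). [cite: BhargavaSkinnerZhang2014, Lemma 19 (proof)] -/
theorem sq_dvd_and_cube_dvd {ℓ : ℕ} (hℓ : ℓ.Prime) (h5 : 5 ≤ ℓ) {A B : ℤ} (hA : (ℓ : ℤ) ∣ A)
    (hΔ : (ℓ : ℤ) ^ 5 ∣ 4 * A ^ 3 + 27 * B ^ 2) : (ℓ : ℤ) ^ 2 ∣ A ∧ (ℓ : ℤ) ^ 3 ∣ B := by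
  have hp : Prime (ℓ : ℤ) := Nat.prime_iff_prime_int.mp hℓ
  have hl0 : (ℓ : ℤ) ≠ 0 := by exact_mod_cast hℓ.ne_zero
  obtain ⟨a, rfl⟩ := hA
  have h1 : (ℓ : ℤ) ∣ 4 * (ℓ * a) ^ 3 + 27 * B ^ 2 := (dvd_pow_self (ℓ : ℤ) (by norm_num)).trans hΔ
  have hB : (ℓ : ℤ) ∣ B := by
    have h4 : (ℓ : ℤ) ∣ 4 * (ℓ * a) ^ 3 := ⟨4 * ℓ ^ 2 * a ^ 3, by ring⟩
    exact hp.dvd_of_dvd_pow (dvd_of_dvd_mul_27 hℓ h5 ((dvd_add_right h4).mp h1))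
  obtain ⟨b, rfl⟩ := hB
  have h2 : (ℓ : ℤ) ^ 3 ∣ 4 * ℓ * a ^ 3 + 27 * b ^ 2 := by
    rw [show (ℓ : ℤ) ^ 5 = (ℓ : ℤ) ^ 2 * (ℓ : ℤ) ^ 3 by ring,
      show 4 * ((ℓ : ℤ) * a) ^ 3 + 27 * ((ℓ : ℤ) * b) ^ 2 =
        (ℓ : ℤ) ^ 2 * (4 * ℓ * a ^ 3 + 27 * b ^ 2) by ring] at hΔ
    exact (mul_dvd_mul_iff_left (pow_ne_zero 2 hl0)).mp hΔ
  have hb : (ℓ : ℤ) ∣ b := by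
    have h3 : (ℓ : ℤ) ∣ 4 * ℓ * a ^ 3 + 27 * b ^ 2 := (dvd_pow_self (ℓ : ℤ) (by norm_num)).trans h2
    have h4 : (ℓ : ℤ) ∣ 4 * ℓ * a ^ 3 := ⟨4 * a ^ 3, by ring⟩
    exact hp.dvd_of_dvd_pow (dvd_of_dvd_mul_27 hℓ h5 ((dvd_add_right h4).mp h3))
  obtain ⟨c, rfl⟩ := hb
  have h4 : (ℓ : ℤ) ^ 2 ∣ 4 * a ^ 3 + 27 * ℓ * c ^ 2 := by
    rw [show (ℓ : ℤ) ^ 3 = (ℓ : ℤ) * (ℓ : ℤ) ^ 2 by ring,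
      show 4 * (ℓ : ℤ) * a ^ 3 + 27 * ((ℓ : ℤ) * c) ^ 2 =
        (ℓ : ℤ) * (4 * a ^ 3 + 27 * ℓ * c ^ 2) by ring] at h2
    exact (mul_dvd_mul_iff_left hl0).mp h2
  have ha : (ℓ : ℤ) ∣ a := by
    have h5' : (ℓ : ℤ) ∣ 4 * a ^ 3 + 27 * ℓ * c ^ 2 := (dvd_pow_self (ℓ : ℤ) two_ne_zero).trans h4
    have h6 : (ℓ : ℤ) ∣ 27 * ℓ * c ^ 2 := ⟨27 * c ^ 2, by ring⟩
    exact hp.dvd_of_dvd_pow (dvd_of_dvd_mul_4 hℓ h5 ((dvd_add_left h6).mp h5'))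
  obtain ⟨d, rfl⟩ := ha
  have hc : (ℓ : ℤ) ∣ c := by
    rw [show 4 * ((ℓ : ℤ) * d) ^ 3 + 27 * (ℓ : ℤ) * c ^ 2 =
        (ℓ : ℤ) * (4 * ℓ ^ 2 * d ^ 3 + 27 * c ^ 2) by ring, pow_two,
      mul_dvd_mul_iff_left hl0] at h4
    have h7 : (ℓ : ℤ) ∣ 4 * ((ℓ : ℤ) * ℓ) * d ^ 3 := ⟨4 * ℓ * d ^ 3, by ring⟩
    exact hp.dvd_of_dvd_pow (dvd_of_dvd_mul_27 hℓ h5 ((dvd_add_right h7).mp h4))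
  obtain ⟨e, rfl⟩ := hc
  exact ⟨⟨d, by ring⟩, ⟨e, by ring⟩⟩

/-- `ℓ³ ∣ A` and `ℓ⁹ ∣ 4A³ + 27B²` force `ℓ⁵ ∣ B` (`ℓ ≥ 5` prime). [folklore] -/
theorem pow_five_dvd_of_cube_dvd {ℓ : ℕ} (hℓ : ℓ.Prime) (h5 : 5 ≤ ℓ) {A B : ℤ}
    (hA : (ℓ : ℤ) ^ 3 ∣ A) (hΔ : (ℓ : ℤ) ^ 9 ∣ 4 * A ^ 3 + 27 * B ^ 2) : (ℓ : ℤ) ^ 5 ∣ B := by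
  have hp : Prime (ℓ : ℤ) := Nat.prime_iff_prime_int.mp hℓ
  have hl0 : (ℓ : ℤ) ≠ 0 := by exact_mod_cast hℓ.ne_zero
  have hB3 : (ℓ : ℤ) ^ 3 ∣ B :=
    (sq_dvd_and_cube_dvd hℓ h5 ((dvd_pow_self (ℓ : ℤ) three_ne_zero).trans hA)
      ((pow_dvd_pow (ℓ : ℤ) (by norm_num : 5 ≤ 9)).trans hΔ)).2
  obtain ⟨a, rfl⟩ := hA
  obtain ⟨c, rfl⟩ := hB3
  -- `ℓ⁹ ∣ 27 ℓ⁶ c²`, so `ℓ³ ∣ 27 c²`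
  have h1 : (ℓ : ℤ) ^ 9 ∣ 27 * ((ℓ : ℤ) ^ 3 * c) ^ 2 := by
    have h4 : (ℓ : ℤ) ^ 9 ∣ 4 * ((ℓ : ℤ) ^ 3 * a) ^ 3 := ⟨4 * a ^ 3, by ring⟩
    exact (dvd_add_right h4).mp hΔ
  have h2 : (ℓ : ℤ) ^ 3 ∣ 27 * c ^ 2 := by
    rw [show 27 * ((ℓ : ℤ) ^ 3 * c) ^ 2 = (ℓ : ℤ) ^ 6 * (27 * c ^ 2) by ring,
      show (ℓ : ℤ) ^ 9 = (ℓ : ℤ) ^ 6 * (ℓ : ℤ) ^ 3 by ring] at h1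
    exact (mul_dvd_mul_iff_left (pow_ne_zero 6 hl0)).mp h1
  have hc : (ℓ : ℤ) ∣ c :=
    hp.dvd_of_dvd_pow (dvd_of_dvd_mul_27 hℓ h5 ((dvd_pow_self (ℓ : ℤ) three_ne_zero).trans h2))
  obtain ⟨c₁, rfl⟩ := hc
  have h3 : (ℓ : ℤ) ∣ 27 * c₁ ^ 2 := by
    rw [show 27 * ((ℓ : ℤ) * c₁) ^ 2 = (ℓ : ℤ) ^ 2 * (27 * c₁ ^ 2) by ring,
      show (ℓ : ℤ) ^ 3 = (ℓ : ℤ) ^ 2 * (ℓ : ℤ) by ring] at h2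
    exact (mul_dvd_mul_iff_left (pow_ne_zero 2 hl0)).mp h2
  have hc₁ : (ℓ : ℤ) ∣ c₁ := hp.dvd_of_dvd_pow (dvd_of_dvd_mul_27 hℓ h5 h3)
  obtain ⟨c₂, rfl⟩ := hc₁
  exact ⟨c₂, by ring⟩

/-- **The trichotomy at a fixed prime.** For a prime `ℓ ≥ 5` and `(A, B)` with
`Δ' = 4A³ + 27B² ≠ 0`, `ℓ ∣ Δ'` and `5 ∣ ord_ℓ(Δ')`: either `ℓ ∤ A` and `ℓ⁵ ∣ Δ'`; or `ℓ³ ∣ A` and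
`ℓ⁵ ∣ B`; or `A = ℓ²a`, `B = ℓ³b` with `ℓ ∤ a` and `ℓ⁴ ∣ 4a³ + 27b²` (as `ord_ℓ(Δ') ≥ 5`, and `≥ 10`
once `ℓ ∣ A`). [cite: BhargavaSkinnerZhang2014, Lemma 19 (proof)] -/
theorem trichotomy {ℓ : ℕ} (hℓ : ℓ.Prime) (h5 : 5 ≤ ℓ) {A B : ℤ} (hΔ0 : 4 * A ^ 3 + 27 * B ^ 2 ≠ 0)
    (hdvd : (ℓ : ℤ) ∣ 4 * A ^ 3 + 27 * B ^ 2) (hord : 5 ∣ padicValInt ℓ (4 * A ^ 3 + 27 * B ^ 2)) :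
    (¬ (ℓ : ℤ) ∣ A ∧ (ℓ : ℤ) ^ 5 ∣ 4 * A ^ 3 + 27 * B ^ 2) ∨
      ((ℓ : ℤ) ^ 3 ∣ A ∧ (ℓ : ℤ) ^ 5 ∣ B) ∨
      (∃ a b : ℤ, A = (ℓ : ℤ) ^ 2 * a ∧ B = (ℓ : ℤ) ^ 3 * b ∧ ¬ (ℓ : ℤ) ∣ a ∧
        (ℓ : ℤ) ^ 4 ∣ 4 * a ^ 3 + 27 * b ^ 2) := by
  haveI := Fact.mk hℓ
  have hl0 : (ℓ : ℤ) ≠ 0 := by exact_mod_cast hℓ.ne_zero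
  set v := padicValInt ℓ (4 * A ^ 3 + 27 * B ^ 2) with hv
  have hv1 : 1 ≤ v := by
    have := (padicValInt_dvd_iff (p := ℓ) 1 (4 * A ^ 3 + 27 * B ^ 2)).mp (by rwa [pow_one])
    tauto
  obtain ⟨w, hw⟩ := hord
  have hv5 : 5 ≤ v := by omega
  have hΔ5 : (ℓ : ℤ) ^ 5 ∣ 4 * A ^ 3 + 27 * B ^ 2 :=
    (padicValInt_dvd_iff (p := ℓ) 5 _).mpr (Or.inr hv5)
  by_cases hA : (ℓ : ℤ) ∣ A
  · right
    obtain ⟨⟨a, rfl⟩, ⟨b, rfl⟩⟩ := sq_dvd_and_cube_dvd hℓ h5 hA hΔ5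
    -- `ord_ℓ Δ' ≥ 6`, hence `≥ 10`
    have hΔ6 : (ℓ : ℤ) ^ 6 ∣ 4 * ((ℓ : ℤ) ^ 2 * a) ^ 3 + 27 * ((ℓ : ℤ) ^ 3 * b) ^ 2 :=
      ⟨4 * a ^ 3 + 27 * b ^ 2, by ring⟩
    have hv6 : 6 ≤ v := by
      have := (padicValInt_dvd_iff (p := ℓ) 6 _).mp hΔ6
      tauto
    have hv10 : 10 ≤ v := by omega
    have hΔ10 : (ℓ : ℤ) ^ 10 ∣ 4 * ((ℓ : ℤ) ^ 2 * a) ^ 3 + 27 * ((ℓ : ℤ) ^ 3 * b) ^ 2 :=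
      (padicValInt_dvd_iff (p := ℓ) 10 _).mpr (Or.inr hv10)
    by_cases h3 : (ℓ : ℤ) ^ 3 ∣ (ℓ : ℤ) ^ 2 * a
    · left
      exact ⟨h3, pow_five_dvd_of_cube_dvd hℓ h5 h3
        ((pow_dvd_pow (ℓ : ℤ) (by norm_num : 9 ≤ 10)).trans hΔ10)⟩
    · right
      refine ⟨a, b, rfl, rfl, fun ha ↦ h3 ?_, ?_⟩
      · rw [pow_succ]
        exact mul_dvd_mul_left _ ha
      · rw [show 4 * ((ℓ : ℤ) ^ 2 * a) ^ 3 + 27 * ((ℓ : ℤ) ^ 3 * b) ^ 2 =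
            (ℓ : ℤ) ^ 6 * (4 * a ^ 3 + 27 * b ^ 2) by ring,
          show (ℓ : ℤ) ^ 10 = (ℓ : ℤ) ^ 6 * (ℓ : ℤ) ^ 4 by ring] at hΔ10
        exact (mul_dvd_mul_iff_left (pow_ne_zero 6 hl0)).mp hΔ10
  · left
    exact ⟨hA, hΔ5⟩

/-! ### §B Square roots modulo `ℓⁿ` and residue classes in an interval -/

/-- `4 ≠ 0` modulo any `q ≥ 5`. [folklore] -/
theorem four_ne_zero_zmod {q : ℕ} (h5 : 5 ≤ q) : (4 : ZMod q) ≠ 0 := by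
  intro h
  have h' : ((4 : ℕ) : ZMod q) = 0 := by exact_mod_cast h
  rw [ZMod.natCast_eq_zero_iff] at h'
  have := Nat.le_of_dvd (by norm_num) h'
  omega

/-- **At most two square roots**: for a prime `ℓ ≥ 5`, `n ≥ 1` and `a (mod ℓⁿ)` with `ℓ ∤ a`, at most
two `r (mod ℓⁿ)` satisfy `4a³ + 27r² = 0` (the roots reduce to `±b₀ (mod ℓ)`, and `r ↦ 4a³ + 27r²` is
injective on each disc; `BSZLemma18.castHom_eq_or_eq_neg`, `BSZLemma18.eq_of_disc_of_eq`). [folklore] -/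
theorem card_roots_le_two {ℓ : ℕ} [hp : Fact ℓ.Prime] (h5 : 5 ≤ ℓ) {n : ℕ} (hn : 0 < n)
    (a : ZMod (ℓ ^ n)) (ha : ZMod.castHom (dvd_pow_self ℓ hn.ne') (ZMod ℓ) a ≠ 0) :
    ((Finset.univ : Finset (ZMod (ℓ ^ n))).filter (fun r ↦ 4 * a ^ 3 + 27 * r ^ 2 = 0)).card ≤ 2 := by
  set red := ZMod.castHom (dvd_pow_self ℓ hn.ne') (ZMod ℓ) with hred
  set roots := (Finset.univ : Finset (ZMod (ℓ ^ n))).filter (fun r ↦ 4 * a ^ 3 + 27 * r ^ 2 = 0)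
    with hroots
  rcases roots.eq_empty_or_nonempty with h0 | ⟨r₀, hr₀⟩
  · rw [h0]; simp
  have hr₀' : 4 * a ^ 3 + 27 * r₀ ^ 2 = 0 := (Finset.mem_filter.mp hr₀).2
  have hroot : 4 * (red a) ^ 3 + 27 * (red r₀) ^ 2 = 0 := by
    have h := congrArg red hr₀'
    rwa [map_add, map_mul, map_mul, map_pow, map_pow, map_ofNat, map_ofNat, map_zero] at h
  have hb₀ : red r₀ ≠ 0 := by
    intro hb
    rw [hb, zero_pow two_ne_zero, mul_zero, add_zero] at hroot
    rcases mul_eq_zero.mp hroot with h4 | h3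
    · exact four_ne_zero_zmod h5 h4
    · exact ha (pow_eq_zero_iff (n := 3) three_ne_zero |>.mp h3)
  have hdisc : ∀ r ∈ roots, red r = red r₀ ∨ red r = -red r₀ := by
    intro r hr
    have hr' : 4 * a ^ 3 + 27 * r ^ 2 = 0 := (Finset.mem_filter.mp hr).2
    refine BSZLemma18.castHom_eq_or_eq_neg (dvd_pow_self ℓ hn.ne') h5 a hroot ?_
    rw [hr', map_zero]
  have hsub : roots ⊆ roots.filter (fun r ↦ red r = red r₀) ∪ roots.filter (fun r ↦ red r = -red r₀) := by
    intro r hr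
    rcases hdisc r hr with h1 | h1
    · exact Finset.mem_union_left _ (Finset.mem_filter.mpr ⟨hr, h1⟩)
    · exact Finset.mem_union_right _ (Finset.mem_filter.mpr ⟨hr, h1⟩)
  have hone : ∀ b : ZMod ℓ, b ≠ 0 → (roots.filter (fun r ↦ red r = b)).card ≤ 1 := by
    intro b hb
    refine Finset.card_le_one.mpr fun r₁ h₁ r₂ h₂ ↦ ?_
    rw [Finset.mem_filter] at h₁ h₂
    have e₁ : 4 * a ^ 3 + 27 * r₁ ^ 2 = 0 := (Finset.mem_filter.mp h₁.1).2
    have e₂ : 4 * a ^ 3 + 27 * r₂ ^ 2 = 0 := (Finset.mem_filter.mp h₂.1).2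
    exact BSZLemma18.eq_of_disc_of_eq hn (dvd_pow_self ℓ hn.ne') h5 a hb h₁.2 h₂.2 (by rw [e₁, e₂])
  calc roots.card
      ≤ (roots.filter (fun r ↦ red r = red r₀) ∪ roots.filter (fun r ↦ red r = -red r₀)).card :=
        Finset.card_le_card hsub
    _ ≤ (roots.filter (fun r ↦ red r = red r₀)).card +
          (roots.filter (fun r ↦ red r = -red r₀)).card := Finset.card_union_le _ _
    _ ≤ 1 + 1 := add_le_add (hone _ hb₀) (hone _ (neg_ne_zero.mpr hb₀))

/-- At most `2R/N + 2` integers `b`, `|b| < R`, lie in a given residue class modulo `N`. [folklore] -/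
theorem card_filter_cast_eq_le {R : ℝ} (hR : 0 < R) {N : ℕ} (hN : 0 < N) (r : ZMod N) :
    (((intBall R).filter (fun b : ℤ ↦ (b : ZMod N) = r)).card : ℝ) ≤ 2 * R / N + 2 := by
  have h := abs_card_filter_dvd_and_cast_eq_sub_le hR one_pos hN (Nat.coprime_one_left N) 0 r
  have hf : (intBall R).filter (fun b : ℤ ↦ ((1 : ℕ) : ℤ) ^ 0 ∣ b ∧ (b : ZMod N) = r) =
      (intBall R).filter (fun b : ℤ ↦ (b : ZMod N) = r) :=
    Finset.filter_congr fun b _ ↦ by simp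
  rw [hf, Nat.cast_one, one_pow, div_one] at h
  linarith [(abs_le.mp h).2]

/-- **The key count.** For a prime `ℓ ≥ 5`, `n ≥ 1` and an integer `a` with `ℓ ∤ a`: at most
`2(2R/ℓⁿ + 2)` integers `b`, `|b| < R`, satisfy `ℓⁿ ∣ 4a³ + 27b²` (two classes modulo `ℓⁿ` at most;
the source, proof of Lemma 19: "`ord_ℓ(Δ(A,B)) = k` if and only if `B` belongs to one of `2(ℓ-1)`
residue classes modulo `ℓ^{k+1}`"). [cite: BhargavaSkinnerZhang2014, Lemma 19 (proof)] -/
theorem card_filter_pow_dvd_disc_le {ℓ : ℕ} (hℓ : ℓ.Prime) (h5 : 5 ≤ ℓ) {n : ℕ} (hn : 0 < n)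
    {a : ℤ} (ha : ¬ (ℓ : ℤ) ∣ a) {R : ℝ} (hR : 0 < R) :
    (((intBall R).filter (fun b : ℤ ↦ (ℓ : ℤ) ^ n ∣ 4 * a ^ 3 + 27 * b ^ 2)).card : ℝ) ≤
      2 * (2 * R / (ℓ : ℝ) ^ n + 2) := by
  haveI := Fact.mk hℓ
  haveI : NeZero (ℓ ^ n) := ⟨pow_ne_zero n hℓ.ne_zero⟩
  have hN : 0 < ℓ ^ n := pow_pos hℓ.pos n
  set roots := (Finset.univ : Finset (ZMod (ℓ ^ n))).filter
    (fun r ↦ 4 * ((a : ZMod (ℓ ^ n))) ^ 3 + 27 * r ^ 2 = 0) with hroots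
  have hiff : ∀ b : ℤ, ((ℓ : ℤ) ^ n ∣ 4 * a ^ 3 + 27 * b ^ 2) ↔ ((b : ZMod (ℓ ^ n)) ∈ roots) := by
    intro b
    rw [hroots, Finset.mem_filter]
    simp only [Finset.mem_univ, true_and]
    rw [show (4 * (a : ZMod (ℓ ^ n)) ^ 3 + 27 * (b : ZMod (ℓ ^ n)) ^ 2) =
        ((4 * a ^ 3 + 27 * b ^ 2 : ℤ) : ZMod (ℓ ^ n)) by push_cast; ring,
      ZMod.intCast_zmod_eq_zero_iff_dvd]
    push_cast
    rfl
  set s := (intBall R).filter (fun b : ℤ ↦ (ℓ : ℤ) ^ n ∣ 4 * a ^ 3 + 27 * b ^ 2) with hs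
  have hmaps : (s : Set ℤ).MapsTo (fun b : ℤ ↦ (b : ZMod (ℓ ^ n))) roots := by
    intro b hb
    have hb' : b ∈ s := hb
    rw [hs, Finset.mem_filter] at hb'
    exact (hiff b).mp hb'.2
  have hfib := Finset.card_eq_sum_card_fiberwise hmaps
  have hle : ∀ r ∈ roots, ((s.filter (fun b : ℤ ↦ (b : ZMod (ℓ ^ n)) = r)).card : ℝ) ≤
      2 * R / (ℓ : ℝ) ^ n + 2 := by
    intro r _
    have hsub : s.filter (fun b : ℤ ↦ (b : ZMod (ℓ ^ n)) = r) ⊆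
        (intBall R).filter (fun b : ℤ ↦ (b : ZMod (ℓ ^ n)) = r) := by
      intro b hb
      rw [Finset.mem_filter] at hb ⊢
      exact ⟨(Finset.mem_filter.mp hb.1).1, hb.2⟩
    have h1 := card_filter_cast_eq_le hR hN r
    push_cast at h1
    calc ((s.filter (fun b : ℤ ↦ (b : ZMod (ℓ ^ n)) = r)).card : ℝ)
        ≤ ((intBall R).filter (fun b : ℤ ↦ (b : ZMod (ℓ ^ n)) = r)).card := by
          exact_mod_cast Finset.card_le_card hsub
      _ ≤ 2 * R / (ℓ : ℝ) ^ n + 2 := h1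
  have hroots2 : roots.card ≤ 2 := by
    refine card_roots_le_two h5 hn (a : ZMod (ℓ ^ n)) ?_
    rw [map_intCast, ne_eq, ZMod.intCast_zmod_eq_zero_iff_dvd]
    exact ha
  have hroots2' : (roots.card : ℝ) ≤ 2 := by exact_mod_cast hroots2
  have hpos : 0 ≤ 2 * R / (ℓ : ℝ) ^ n + 2 := by positivity
  calc (s.card : ℝ) = ∑ r ∈ roots, ((s.filter (fun b : ℤ ↦ (b : ZMod (ℓ ^ n)) = r)).card : ℝ) := by
        rw [hfib]; push_cast; rfl
    _ ≤ ∑ r ∈ roots, (2 * R / (ℓ : ℝ) ^ n + 2) := Finset.sum_le_sum hle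
    _ = roots.card * (2 * R / (ℓ : ℝ) ^ n + 2) := by rw [Finset.sum_const, nsmul_eq_mul]
    _ ≤ 2 * (2 * R / (ℓ : ℝ) ^ n + 2) := mul_le_mul_of_nonneg_right hroots2' hpos

/-! ### §C Box counts -/

/-- **Pairs with `ℓ ∤ a`, `ℓⁿ ∣ 4a³ + 27b²` in a product of intervals**: at most
`(2R + 1)·2(2R'/ℓⁿ + 2)`. [folklore] -/
theorem card_filter_prod_not_dvd_and_pow_dvd_disc_le {ℓ : ℕ} (hℓ : ℓ.Prime) (h5 : 5 ≤ ℓ) {n : ℕ}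
    (hn : 0 < n) {R R' : ℝ} (hR : 0 < R) (hR' : 0 < R') :
    (((intBall R ×ˢ intBall R').filter (fun ab : ℤ × ℤ ↦ ¬ (ℓ : ℤ) ∣ ab.1 ∧
        (ℓ : ℤ) ^ n ∣ 4 * ab.1 ^ 3 + 27 * ab.2 ^ 2)).card : ℝ) ≤
      (2 * R + 1) * (2 * (2 * R' / (ℓ : ℝ) ^ n + 2)) := by
  rw [Finset.natCast_card_filter, Finset.sum_product]
  have hinner : ∀ a ∈ intBall R,
      (∑ b ∈ intBall R', (if ¬ (ℓ : ℤ) ∣ (a, b).1 ∧ (ℓ : ℤ) ^ n ∣ 4 * (a, b).1 ^ 3 + 27 * (a, b).2 ^ 2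
        then (1 : ℝ) else 0)) ≤ 2 * (2 * R' / (ℓ : ℝ) ^ n + 2) := by
    intro a _
    by_cases ha : (ℓ : ℤ) ∣ a
    · rw [Finset.sum_eq_zero fun b _ ↦ by simp [ha]]
      positivity
    · have h := card_filter_pow_dvd_disc_le hℓ h5 hn ha hR'
      rw [Finset.natCast_card_filter] at h
      refine le_trans (le_of_eq (Finset.sum_congr rfl fun b _ ↦ ?_)) h
      simp [ha]
  calc ∑ a ∈ intBall R, ∑ b ∈ intBall R',
        (if ¬ (ℓ : ℤ) ∣ (a, b).1 ∧ (ℓ : ℤ) ^ n ∣ 4 * (a, b).1 ^ 3 + 27 * (a, b).2 ^ 2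
          then (1 : ℝ) else 0)
      ≤ ∑ a ∈ intBall R, 2 * (2 * R' / (ℓ : ℝ) ^ n + 2) := Finset.sum_le_sum hinner
    _ = (intBall R).card * (2 * (2 * R' / (ℓ : ℝ) ^ n + 2)) := by
        rw [Finset.sum_const, nsmul_eq_mul]
    _ ≤ (2 * R + 1) * (2 * (2 * R' / (ℓ : ℝ) ^ n + 2)) :=
        mul_le_mul_of_nonneg_right (card_intBall_le hR) (by positivity)

/-- **Pairs with `m₁ ∣ A`, `m₂ ∣ B` in the box**: at most `(2R₁/m₁ + 1)(2R₂/m₂ + 1)`. [folklore] -/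
theorem card_box_filter_dvd_dvd_le {X : ℕ} (hX : 1 ≤ X) {m₁ m₂ : ℤ} (h₁ : 0 < m₁) (h₂ : 0 < m₂) :
    (((box X).filter (fun AB : ℤ × ℤ ↦ m₁ ∣ AB.1 ∧ m₂ ∣ AB.2)).card : ℝ) ≤
      (2 * (R₁ X / m₁) + 1) * (2 * (R₂ X / m₂) + 1) := by
  have key : (box X).filter (fun AB : ℤ × ℤ ↦ m₁ ∣ AB.1 ∧ m₂ ∣ AB.2) =
      (intBall (R₁ X)).filter (fun A ↦ m₁ ∣ A) ×ˢ (intBall (R₂ X)).filter (fun B ↦ m₂ ∣ B) := by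
    ext ⟨A, B⟩
    simp only [box, Finset.mem_filter, Finset.mem_product]
    tauto
  have h₁' : (0 : ℝ) < m₁ := by exact_mod_cast h₁
  have h₂' : (0 : ℝ) < m₂ := by exact_mod_cast h₂
  rw [key, Finset.card_product, card_filter_dvd_intBall h₁, card_filter_dvd_intBall h₂, Nat.cast_mul]
  have b1 := card_intBall_le (R := R₁ X / m₁) (div_pos (R₁_pos hX) h₁')
  have b2 := card_intBall_le (R := R₂ X / m₂) (div_pos (R₂_pos hX) h₂')
  have n2 : 0 ≤ 2 * (R₂ X / (m₂ : ℝ)) + 1 := by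
    have := div_nonneg (R₂_nonneg X) h₂'.le; linarith
  exact mul_le_mul b1 b2 (Nat.cast_nonneg _) (by have := div_nonneg (R₁_nonneg X) h₁'.le; linarith)

/-- **The piece `A = ℓ²a`, `B = ℓ³b`, `ℓ ∤ a`, `ℓ⁴ ∣ 4a³ + 27b²` in the box**: at most
`(2R₁/ℓ² + 1)·2(2(R₂/ℓ³)/ℓ⁴ + 2)` (rescale to `(a, b)` with `|a| < R₁/ℓ²`, `|b| < R₂/ℓ³`). [folklore] -/
theorem card_box_filter_rescaled_le {X : ℕ} (hX : 1 ≤ X) {ℓ : ℕ} (hℓ : ℓ.Prime) (h5 : 5 ≤ ℓ) :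
    (((box X).filter (fun AB : ℤ × ℤ ↦ ∃ a b : ℤ, AB.1 = (ℓ : ℤ) ^ 2 * a ∧ AB.2 = (ℓ : ℤ) ^ 3 * b ∧
        ¬ (ℓ : ℤ) ∣ a ∧ (ℓ : ℤ) ^ 4 ∣ 4 * a ^ 3 + 27 * b ^ 2)).card : ℝ) ≤
      (2 * (R₁ X / (ℓ : ℝ) ^ 2) + 1) * (2 * (2 * (R₂ X / (ℓ : ℝ) ^ 3) / (ℓ : ℝ) ^ 4 + 2)) := by
  have hl : (0 : ℝ) < ℓ := by exact_mod_cast hℓ.pos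
  have hR : 0 < R₁ X / (ℓ : ℝ) ^ 2 := div_pos (R₁_pos hX) (by positivity)
  have hR' : 0 < R₂ X / (ℓ : ℝ) ^ 3 := div_pos (R₂_pos hX) (by positivity)
  set T := (intBall (R₁ X / (ℓ : ℝ) ^ 2) ×ˢ intBall (R₂ X / (ℓ : ℝ) ^ 3)).filter
    (fun ab : ℤ × ℤ ↦ ¬ (ℓ : ℤ) ∣ ab.1 ∧ (ℓ : ℤ) ^ 4 ∣ 4 * ab.1 ^ 3 + 27 * ab.2 ^ 2) with hT
  have hsub : (box X).filter (fun AB : ℤ × ℤ ↦ ∃ a b : ℤ, AB.1 = (ℓ : ℤ) ^ 2 * a ∧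
      AB.2 = (ℓ : ℤ) ^ 3 * b ∧ ¬ (ℓ : ℤ) ∣ a ∧ (ℓ : ℤ) ^ 4 ∣ 4 * a ^ 3 + 27 * b ^ 2) ⊆
      T.image (fun ab : ℤ × ℤ ↦ ((ℓ : ℤ) ^ 2 * ab.1, (ℓ : ℤ) ^ 3 * ab.2)) := by
    rintro ⟨A, B⟩ hAB
    rw [Finset.mem_filter, box, Finset.mem_product, mem_intBall, mem_intBall] at hAB
    obtain ⟨⟨hA, hB⟩, a, b, rfl, rfl, ha, hdvd⟩ := hAB
    rw [Finset.mem_image]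
    refine ⟨(a, b), ?_, rfl⟩
    rw [hT, Finset.mem_filter, Finset.mem_product, mem_intBall, mem_intBall]
    refine ⟨⟨?_, ?_⟩, ha, hdvd⟩
    · rw [lt_div_iff₀ (by positivity)]
      have : |(((ℓ : ℤ) ^ 2 * a : ℤ) : ℝ)| = |(a : ℝ)| * (ℓ : ℝ) ^ 2 := by
        push_cast
        rw [abs_mul, abs_of_pos (by positivity : (0 : ℝ) < (ℓ : ℝ) ^ 2), mul_comm]
      rwa [this] at hA
    · rw [lt_div_iff₀ (by positivity)]
      have : |(((ℓ : ℤ) ^ 3 * b : ℤ) : ℝ)| = |(b : ℝ)| * (ℓ : ℝ) ^ 3 := by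
        push_cast
        rw [abs_mul, abs_of_pos (by positivity : (0 : ℝ) < (ℓ : ℝ) ^ 3), mul_comm]
      rwa [this] at hB
  calc (((box X).filter (fun AB : ℤ × ℤ ↦ ∃ a b : ℤ, AB.1 = (ℓ : ℤ) ^ 2 * a ∧
          AB.2 = (ℓ : ℤ) ^ 3 * b ∧ ¬ (ℓ : ℤ) ∣ a ∧ (ℓ : ℤ) ^ 4 ∣ 4 * a ^ 3 + 27 * b ^ 2)).card : ℝ)
      ≤ (T.image (fun ab : ℤ × ℤ ↦ ((ℓ : ℤ) ^ 2 * ab.1, (ℓ : ℤ) ^ 3 * ab.2))).card := by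
        exact_mod_cast Finset.card_le_card hsub
    _ ≤ T.card := by exact_mod_cast Finset.card_image_le
    _ ≤ (2 * (R₁ X / (ℓ : ℝ) ^ 2) + 1) * (2 * (2 * (R₂ X / (ℓ : ℝ) ^ 3) / (ℓ : ℝ) ^ 4 + 2)) :=
        card_filter_prod_not_dvd_and_pow_dvd_disc_le hℓ h5 (by norm_num) hR hR'


/-! ### §D The exact density of `{ℓ ∤ A, ℓ^{k+2} ∣ 4A³ + 27B²}` -/

/-- **The residue count with target `0`**: for `p ≥ 5`, `k ≥ 1`, the pairs `(a, b) (mod p^{k+2})` with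
`a` an admissible unit and `4a³ + 27b² ≡ 0 (mod p^{k+2})` number `(p-1)/2 · p^{k+1} · 2` (two classes
of `b` for each admissible `a`: `bsz_lemma18_card_residues_eq` with `Z = {0}`).
[cite: BhargavaSkinnerZhang2014, Lemma 19 (proof)] -/
theorem card_pairs_zero {p : ℕ} [hp : Fact p.Prime] (hp5 : 5 ≤ p) {k : ℕ} (hk : 1 ≤ k) :
    ((Finset.univ : Finset (ZMod (p ^ (k + 2)) × ZMod (p ^ (k + 2)))).filter (fun r ↦
      (ZMod.castHom (BSZLemma19.dvd_pow k) (ZMod p) r.1 ≠ 0 ∧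
        ∃ b : ZMod p, 4 * (ZMod.castHom (BSZLemma19.dvd_pow k) (ZMod p) r.1) ^ 3 + 27 * b ^ 2 = 0) ∧
      4 * r.1 ^ 3 + 27 * r.2 ^ 2 = 0)).card =
      (p - 1) / 2 * p ^ (k + 1) * 2 := by
  haveI : NeZero (p ^ (k + 2)) := ⟨pow_ne_zero _ hp.out.ne_zero⟩
  haveI : NeZero (p ^ 2) := ⟨pow_ne_zero _ hp.out.ne_zero⟩
  set red := ZMod.castHom (BSZLemma19.dvd_pow k) (ZMod p) with hred
  set Padm : ZMod (p ^ (k + 2)) → Prop := fun a ↦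
      red a ≠ 0 ∧ ∃ b : ZMod p, 4 * (red a) ^ 3 + 27 * b ^ 2 = 0 with hPadm
  -- with `Z = {0}`, the condition `∃ z ∈ Z, 4a³ + 27b² = p^k z` is `4a³ + 27b² = 0`
  have hZ : ∀ a b : ZMod (p ^ (k + 2)),
      (∃ z ∈ ({0} : Finset (ZMod (p ^ 2))), 4 * a ^ 3 + 27 * b ^ 2 =
        (p : ZMod (p ^ (k + 2))) ^ k * (z.val : ZMod (p ^ (k + 2)))) ↔ 4 * a ^ 3 + 27 * b ^ 2 = 0 := by
    intro a b
    simp only [Finset.mem_singleton, exists_eq_left, ZMod.val_zero, Nat.cast_zero, mul_zero]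
  have hcount : ∀ a : ZMod (p ^ (k + 2)), Padm a →
      ((Finset.univ : Finset (ZMod (p ^ (k + 2)))).filter
        (fun b ↦ 4 * a ^ 3 + 27 * b ^ 2 = 0)).card = 2 := by
    intro a ha
    have h := bsz_lemma18_card_residues_eq hp5 hk a ha.1 ha.2 ({0} : Finset (ZMod (p ^ 2)))
    rw [Finset.card_singleton, mul_one] at h
    refine Eq.trans ?_ h
    congr 1
    exact Finset.filter_congr fun b _ ↦ (hZ a b).symm
  rw [Finset.card_filter, ← Finset.univ_product_univ, Finset.sum_product]
  have hinner : ∀ a : ZMod (p ^ (k + 2)),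
      (∑ b : ZMod (p ^ (k + 2)), if Padm (a, b).1 ∧ 4 * (a, b).1 ^ 3 + 27 * (a, b).2 ^ 2 = 0
          then 1 else 0) = if Padm a then 2 else 0 := by
    intro a
    by_cases ha : Padm a
    · rw [if_pos ha]
      calc (∑ b : ZMod (p ^ (k + 2)),
            if Padm (a, b).1 ∧ 4 * (a, b).1 ^ 3 + 27 * (a, b).2 ^ 2 = 0 then 1 else 0)
          = ∑ b : ZMod (p ^ (k + 2)), (if 4 * a ^ 3 + 27 * b ^ 2 = 0 then 1 else 0) :=
            Finset.sum_congr rfl fun b _ ↦ by simp [ha]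
        _ = ((Finset.univ : Finset (ZMod (p ^ (k + 2)))).filter
              (fun b ↦ 4 * a ^ 3 + 27 * b ^ 2 = 0)).card := (Finset.card_filter _ _).symm
        _ = 2 := hcount a ha
    · rw [if_neg ha]
      exact Finset.sum_eq_zero fun b _ ↦ by simp [ha]
  have hadm : ((Finset.univ : Finset (ZMod (p ^ (k + 2)))).filter (fun x ↦ Padm x)).card =
      (p - 1) / 2 * p ^ (k + 1) := by
    simp only [hPadm]
    exact BSZLemma19.card_admissible hp5 k
  rw [Finset.sum_congr rfl fun a _ ↦ hinner a, Finset.sum_ite, Finset.sum_const_zero, add_zero,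
    Finset.sum_const, smul_eq_mul, hadm]

/-- **For a prime `ℓ ≥ 5` and `k ≥ 1`, the set `{ℓ ∤ A, ℓ^{k+2} ∣ 4A³ + 27B²}` (i.e.
`ord_ℓ Δ(A,B) ≥ k + 2` with `ℓ ∤ A`) has height density `(ℓ-1)/ℓ^{k+3} · (1 - ℓ⁻¹⁰)⁻¹`** — the sum
over `j ≥ k+2` of the printed measures `(ℓ-1)²/ℓ^{j+2}` of `{ℓ ∤ A, ord_ℓ = j}` (proof of Lemma 19 of
the source), obtained here directly from the residue count modulo `ℓ^{k+2}` and the one-prime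
local-density formula `hasHeightDensity_residues`. [cite: BhargavaSkinnerZhang2014, Lemma 19 (proof)] -/
theorem hasHeightDensity_not_dvd_and_pow_dvd_disc {p : ℕ} [hp : Fact p.Prime] (hp5 : 5 ≤ p) {k : ℕ}
    (hk : 1 ≤ k) :
    HasHeightDensity (fun AB : ℤ × ℤ ↦ ¬ (p : ℤ) ∣ AB.1 ∧ (p : ℤ) ^ (k + 2) ∣ 4 * AB.1 ^ 3 + 27 * AB.2 ^ 2)
      (((p : ℝ) - 1) / (p : ℝ) ^ (k + 3) / (1 - 1 / (p : ℝ) ^ 10)) := by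
  haveI : NeZero (p ^ (k + 2)) := ⟨pow_ne_zero _ hp.out.ne_zero⟩
  set red := ZMod.castHom (BSZLemma19.dvd_pow (p := p) k) (ZMod p) with hred
  set R : Finset (ZMod (p ^ (k + 2)) × ZMod (p ^ (k + 2))) :=
    (Finset.univ : Finset (ZMod (p ^ (k + 2)) × ZMod (p ^ (k + 2)))).filter (fun r ↦
      (red r.1 ≠ 0 ∧ ∃ b : ZMod p, 4 * (red r.1) ^ 3 + 27 * b ^ 2 = 0) ∧
      4 * r.1 ^ 3 + 27 * r.2 ^ 2 = 0) with hRdef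
  have hmem : ∀ AB : ℤ × ℤ,
      (((AB.1 : ZMod (p ^ (k + 2))), (AB.2 : ZMod (p ^ (k + 2)))) ∈ R) ↔
        (¬ (p : ℤ) ∣ AB.1 ∧ (p : ℤ) ^ (k + 2) ∣ 4 * AB.1 ^ 3 + 27 * AB.2 ^ 2) := by
    intro AB
    have hredA : red (AB.1 : ZMod (p ^ (k + 2))) = (AB.1 : ZMod p) := map_intCast _ _
    rw [hRdef, Finset.mem_filter]
    simp only [Finset.mem_univ, true_and, hredA]
    rw [show (4 * (AB.1 : ZMod (p ^ (k + 2))) ^ 3 + 27 * (AB.2 : ZMod (p ^ (k + 2))) ^ 2) =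
        ((4 * AB.1 ^ 3 + 27 * AB.2 ^ 2 : ℤ) : ZMod (p ^ (k + 2))) by push_cast; ring,
      ZMod.intCast_zmod_eq_zero_iff_dvd, ne_eq, ZMod.intCast_zmod_eq_zero_iff_dvd]
    push_cast
    constructor
    · rintro ⟨⟨hA, -⟩, hk2⟩
      exact ⟨hA, hk2⟩
    · rintro ⟨hA, hk2⟩
      refine ⟨⟨hA, ?_⟩, hk2⟩
      refine ⟨(AB.2 : ZMod p), ?_⟩
      have h5 : (p : ℤ) ∣ 4 * AB.1 ^ 3 + 27 * AB.2 ^ 2 := (dvd_pow_self (p : ℤ) (by omega)).trans hk2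
      have := (ZMod.intCast_zmod_eq_zero_iff_dvd _ p).mpr h5
      push_cast at this
      exact this
  have hR : ∀ AB : ℤ × ℤ, ((AB.1 : ZMod (p ^ (k + 2))), (AB.2 : ZMod (p ^ (k + 2)))) ∈ R →
      ¬ (p : ℤ) ∣ AB.1 := fun AB h ↦ ((hmem AB).mp h).1
  have hcard : R.card = (p - 1) / 2 * p ^ (k + 1) * 2 := by
    rw [hRdef]
    exact card_pairs_zero hp5 hk
  have h := hasHeightDensity_residues hp.out (k + 2) R hR
  have hfun : (fun AB : ℤ × ℤ ↦ ((AB.1 : ZMod (p ^ (k + 2))), (AB.2 : ZMod (p ^ (k + 2)))) ∈ R) =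
      (fun AB : ℤ × ℤ ↦ ¬ (p : ℤ) ∣ AB.1 ∧ (p : ℤ) ^ (k + 2) ∣ 4 * AB.1 ^ 3 + 27 * AB.2 ^ 2) :=
    funext fun AB ↦ propext (hmem AB)
  have hodd : 2 ∣ p - 1 := by
    have hp2 : p % 2 = 1 := by
      rcases Nat.even_or_odd p with he | ho
      · exfalso
        have h2 : 2 ∣ p := even_iff_two_dvd.mp he
        rcases hp.out.eq_one_or_self_of_dvd 2 h2 with h | h <;> omega
      · exact Nat.odd_iff.mp ho
    omega
  have hnat : ((p - 1) / 2 * p ^ (k + 1) * 2 : ℕ) = (p - 1) * p ^ (k + 1) := by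
    obtain ⟨m, hm⟩ := hodd
    rw [hm, Nat.mul_div_cancel_left m two_pos]
    ring
  have hconst : ((R.card : ℕ) : ℝ) / (((p : ℕ) : ℝ) ^ (k + 2)) ^ 2 / (1 - 1 / ((p : ℕ) : ℝ) ^ 10) =
      ((p : ℝ) - 1) / (p : ℝ) ^ (k + 3) / (1 - 1 / (p : ℝ) ^ 10) := by
    rw [hcard, hnat]
    have hp1 : 1 ≤ p := hp.out.one_lt.le
    have hpR : (0 : ℝ) < p := by exact_mod_cast hp.out.pos
    push_cast [Nat.cast_sub hp1]
    congr 1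
    rw [show (k + 3) = (k + 1) + 2 by ring, pow_add, show ((k + 2) : ℕ) = (k + 1) + 1 by ring, pow_add]
    field_simp
    ring
  rwa [hfun, hconst] at h

/-! ### §E From densities and box bounds to eventual counting inequalities -/

/-- A set of height density `d` eventually has at most `(d + η)·#{H < X}` members of height `< X`.
[folklore] -/
theorem eventually_card_filter_le_of_hasHeightDensity {P : ℤ × ℤ → Prop} [DecidablePred P] {d : ℝ}
    (h : HasHeightDensity P d) :
    ∀ η : ℝ, 0 < η → ∀ᶠ X : ℕ in atTop,
      (((heightFamilyBelow X).filter P).card : ℝ) ≤ (d + η) * (heightFamilyBelow X).card := by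
  intro η hη
  have hev : ∀ᶠ X : ℕ in atTop, heightProportion P X < d + η :=
    h.eventually (Iio_mem_nhds (by linarith))
  filter_upwards [hev, eventually_heightFamilyBelow_card_pos] with X hX hpos
  have hN : (0 : ℝ) < (heightFamilyBelow X).card := by exact_mod_cast hpos
  rw [heightProportion_eq_card_div, div_lt_iff₀ hN] at hX
  exact hX.le

/-- `∏_p (1 - p⁻¹⁰) ≥ 1/2` (from `half_le_prod_primes`). [folklore] -/
theorem half_le_tprod_primes : (1 / 2 : ℝ) ≤ ∏' p : Nat.Primes, (1 - 1 / ((p : ℕ) : ℝ) ^ 10) := by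
  by_cases hm : Multipliable (fun p : Nat.Primes ↦ (1 - 1 / ((p : ℕ) : ℝ) ^ 10))
  · exact ge_of_tendsto' hm.hasProd fun s ↦ half_le_prod_primes s
  · rw [tprod_eq_one_of_not_multipliable hm]; norm_num

/-- **From a box bound to a density bound.** If `u(X) ≤ α R₁R₂ + E(X)` with `E(X) = o(X^{5/6})`, then
eventually `u(X) ≤ (α/2 + η)·#{H < X}`: indeed `#{H < X} ~ 4R₁R₂ ∏_p(1 - p⁻¹⁰)`
(`card_heightFamilyBelow_asymptotic_holds`) and `∏_p (1 - p⁻¹⁰) ≥ 1/2`. [folklore] -/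
theorem eventually_le_of_box_bound {u : ℕ → ℝ} {α : ℝ} (hα : 0 ≤ α) {E : ℕ → ℝ}
    (hE : Tendsto (fun X : ℕ ↦ E X / (X : ℝ) ^ (5 / 6 : ℝ)) atTop (𝓝 0))
    (hu : ∀ X : ℕ, 1 ≤ X → u X ≤ α * (R₁ X * R₂ X) + E X) :
    ∀ η : ℝ, 0 < η → ∀ᶠ X : ℕ in atTop, u X ≤ (α / 2 + η) * (heightFamilyBelow X).card := by
  intro η hη
  set c₀ : ℝ := 4 / ((4 : ℝ) ^ (1 / 3 : ℝ) * (27 : ℝ) ^ (1 / 2 : ℝ)) with hc₀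
  set Pinf : ℝ := ∏' p : Nat.Primes, (1 - 1 / ((p : ℕ) : ℝ) ^ 10) with hPinf
  have hc₀pos : 0 < c₀ := by rw [hc₀]; positivity
  have hP : 1 / 2 ≤ Pinf := half_le_tprod_primes
  have hFC : heightFamilyConstant = c₀ * Pinf := rfl
  have hnum : Tendsto (fun X : ℕ ↦ (α * (R₁ X * R₂ X) + E X) / (X : ℝ) ^ (5 / 6 : ℝ)) atTop
      (𝓝 (α * c₀ / 4)) := by
    have h1 : Tendsto (fun X : ℕ ↦ α * (R₁ X * R₂ X) / (X : ℝ) ^ (5 / 6 : ℝ)) atTop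
        (𝓝 (α * c₀ / 4)) := by
      refine tendsto_const_nhds.congr' ?_
      filter_upwards [eventually_ge_atTop 1] with X hX
      have h4 := four_R₁R₂_div hX
      rw [← hc₀] at h4
      rw [← h4]
      ring
    have h2 := h1.add hE
    rw [add_zero] at h2
    refine h2.congr fun X ↦ ?_
    rw [add_div]
  have hden : Tendsto (fun X : ℕ ↦ ((heightFamilyBelow X).card : ℝ) / (X : ℝ) ^ (5 / 6 : ℝ)) atTop
      (𝓝 heightFamilyConstant) := card_heightFamilyBelow_asymptotic_holds
  have hratio : Tendsto (fun X : ℕ ↦ (α * (R₁ X * R₂ X) + E X) / (heightFamilyBelow X).card) atTop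
      (𝓝 (α * c₀ / 4 / heightFamilyConstant)) := by
    have hq := hnum.div hden heightFamilyConstant_pos.ne'
    refine hq.congr' ?_
    filter_upwards [eventually_ge_atTop 1] with X hX
    have hXp : (0 : ℝ) < (X : ℝ) ^ (5 / 6 : ℝ) := Real.rpow_pos_of_pos (by exact_mod_cast hX) _
    simp only [Pi.div_apply]
    rw [div_div_div_cancel_right₀ hXp.ne']
  have hlim : α * c₀ / 4 / heightFamilyConstant ≤ α / 2 := by
    rw [hFC, div_le_iff₀ (mul_pos hc₀pos (by linarith))]
    have : α * c₀ / 4 = α / 2 * (c₀ * (1 / 2)) := by ring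
    rw [this]
    exact mul_le_mul_of_nonneg_left (mul_le_mul_of_nonneg_left hP hc₀pos.le) (by linarith)
  have hev : ∀ᶠ X : ℕ in atTop,
      (α * (R₁ X * R₂ X) + E X) / (heightFamilyBelow X).card < α / 2 + η :=
    hratio.eventually (Iio_mem_nhds (by linarith))
  filter_upwards [hev, eventually_ge_atTop 1, eventually_heightFamilyBelow_card_pos] with X h1 hX hpos
  have hN : (0 : ℝ) < (heightFamilyBelow X).card := by exact_mod_cast hpos
  have h2 := (div_lt_iff₀ hN).mp h1
  linarith [hu X hX]


/-! ### §F The tail: a prime `ℓ > Y` with `ℓ⁵ ∣ 4A³ + 27B²` -/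

/-- `Σ_{Y < n ≤ L} n⁻⁵ ≤ 1/(4Y⁴)` (telescoping `n⁻⁵ ≤ ¼((n-1)⁻⁴ - n⁻⁴)`). [folklore] -/
theorem sum_Ioc_inv_pow_five_le {Y : ℕ} (hY : 1 ≤ Y) (L : ℕ) :
    ∑ n ∈ Finset.Ioc Y L, 1 / (n : ℝ) ^ 5 ≤ 1 / (4 * (Y : ℝ) ^ 4) := by
  have hY0 : (0 : ℝ) < Y := by exact_mod_cast hY
  suffices h : ∀ L, Y ≤ L →
      ∑ n ∈ Finset.Ioc Y L, 1 / (n : ℝ) ^ 5 ≤ 1 / (4 * (Y : ℝ) ^ 4) - 1 / (4 * (L : ℝ) ^ 4) by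
    rcases le_or_gt Y L with hL | hL
    · exact (h L hL).trans (sub_le_self _ (by positivity))
    · rw [Finset.Ioc_eq_empty_of_le hL.le, Finset.sum_empty]; positivity
  intro L hL
  induction L, hL using Nat.le_induction with
  | base => rw [Finset.Ioc_self, Finset.sum_empty, sub_self]
  | succ M hM ih =>
    rw [Finset.sum_Ioc_succ_top hM, Nat.cast_succ]
    have hM0 : (0 : ℝ) < M := by
      have : 1 ≤ M := hY.trans hM
      exact_mod_cast this
    have key : 1 / ((M : ℝ) + 1) ^ 5 ≤ 1 / (4 * (M : ℝ) ^ 4) - 1 / (4 * ((M : ℝ) + 1) ^ 4) := by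
      have e : 1 / (4 * (M : ℝ) ^ 4) - 1 / (4 * ((M : ℝ) + 1) ^ 4) - 1 / ((M : ℝ) + 1) ^ 5 =
          (10 * (M : ℝ) ^ 3 + 10 * (M : ℝ) ^ 2 + 5 * M + 1) /
            (4 * (M : ℝ) ^ 4 * ((M : ℝ) + 1) ^ 5) := by
        field_simp
        ring
      have : 0 ≤ (10 * (M : ℝ) ^ 3 + 10 * (M : ℝ) ^ 2 + 5 * M + 1) /
          (4 * (M : ℝ) ^ 4 * ((M : ℝ) + 1) ^ 5) := by positivity
      linarith
    linarith

/-- Elementary bookkeeping of the two box counts at a prime `ℓ = t ≥ 1`. [folklore] -/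
theorem per_prime_bound {t R R' : ℝ} (ht : 1 ≤ t) (hR : 0 ≤ R) (hR' : 0 ≤ R') :
    (2 * R + 1) * (2 * (2 * R' / t ^ 5 + 2)) + (2 * (R / t ^ 2) + 1) * (2 * (R' / t ^ 3) + 1) ≤
      12 * (R * R') * (1 / t ^ 5) + (10 * R + 6 * R' + 5) := by
  have ht0 : 0 < t := by linarith
  have h2 : 1 ≤ t ^ 2 := one_le_pow₀ ht
  have h3 : 1 ≤ t ^ 3 := one_le_pow₀ ht
  have h5 : 1 ≤ t ^ 5 := one_le_pow₀ ht
  have a1 : R' / t ^ 5 ≤ R' := div_le_self hR' h5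
  have a2 : R / t ^ 2 ≤ R := div_le_self hR h2
  have a3 : R' / t ^ 3 ≤ R' := div_le_self hR' h3
  have expand : (2 * R + 1) * (2 * (2 * R' / t ^ 5 + 2)) + (2 * (R / t ^ 2) + 1) * (2 * (R' / t ^ 3) + 1)
      = 12 * (R * R') * (1 / t ^ 5) + 8 * R + 4 * (R' / t ^ 5) + 2 * (R / t ^ 2) +
          2 * (R' / t ^ 3) + 5 := by
    field_simp
    ring
  rw [expand]
  linarith

/-- **The range of the tail**: for `(A, B)` in the box `H < X` with `4A³ + 27B² ≠ 0`, a prime power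
`ℓ⁵ ∣ 4A³ + 27B²` has `ℓ ≤ (2X)^{1/5}` (`|4A³ + 27B²| < 2X`). [folklore] -/
theorem le_floor_of_pow_five_dvd {X : ℕ} {AB : ℤ × ℤ} (hAB : AB ∈ box X)
    (hΔ0 : 4 * AB.1 ^ 3 + 27 * AB.2 ^ 2 ≠ 0) {ℓ : ℕ}
    (hdvd : (ℓ : ℤ) ^ 5 ∣ 4 * AB.1 ^ 3 + 27 * AB.2 ^ 2) :
    ℓ ≤ ⌊(2 * (X : ℝ)) ^ (1 / 5 : ℝ)⌋₊ := by
  rw [mem_box, naiveHeight, max_lt_iff] at hAB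
  obtain ⟨hA, hB⟩ := hAB
  have hΔlt : |4 * AB.1 ^ 3 + 27 * AB.2 ^ 2| < 2 * (X : ℤ) := by
    have h1 : |4 * AB.1 ^ 3| = 4 * |AB.1| ^ 3 := by
      rw [abs_mul, abs_pow]; norm_num
    have h2 : |27 * AB.2 ^ 2| = 27 * AB.2 ^ 2 := abs_of_nonneg (by positivity)
    calc |4 * AB.1 ^ 3 + 27 * AB.2 ^ 2| ≤ |4 * AB.1 ^ 3| + |27 * AB.2 ^ 2| := abs_add_le _ _
      _ < (X : ℤ) + X := by rw [h1, h2]; exact add_lt_add hA hB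
      _ = 2 * (X : ℤ) := by ring
  have hle : (ℓ : ℤ) ^ 5 ≤ |4 * AB.1 ^ 3 + 27 * AB.2 ^ 2| :=
    Int.le_of_dvd (abs_pos.mpr hΔ0) ((dvd_abs _ _).mpr hdvd)
  have hR : (ℓ : ℝ) ^ 5 ≤ 2 * (X : ℝ) := by
    have h1 : ((ℓ : ℤ) ^ 5 : ℤ) < 2 * (X : ℤ) := lt_of_le_of_lt hle hΔlt
    have h2 : (((ℓ : ℤ) ^ 5 : ℤ) : ℝ) < ((2 * (X : ℤ) : ℤ) : ℝ) := by exact_mod_cast h1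
    push_cast at h2
    exact h2.le
  refine Nat.le_floor ?_
  have h0 : (0 : ℝ) ≤ ℓ := Nat.cast_nonneg _
  calc (ℓ : ℝ) = ((ℓ : ℝ) ^ 5) ^ (1 / 5 : ℝ) := by
        rw [show (1 / 5 : ℝ) = ((5 : ℕ) : ℝ)⁻¹ by norm_num, Real.pow_rpow_inv_natCast h0 (by norm_num)]
    _ ≤ (2 * (X : ℝ)) ^ (1 / 5 : ℝ) := Real.rpow_le_rpow (by positivity) hR (by norm_num)

/-- **The tail count**: for `X ≥ 1` and `Y ≥ 4`, the curves of height `< X` with `ℓ⁵ ∣ 4A³ + 27B²`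
for some prime `ℓ > Y` number at most `3R₁R₂/Y⁴ + ⌊(2X)^{1/5}⌋·(10R₁ + 6R₂ + 5)` — union over the
primes `Y < ℓ ≤ (2X)^{1/5}` of the box counts of `{ℓ ∤ A, ℓ⁵ ∣ 4A³+27B²}` (two classes of `B` modulo
`ℓ⁵` for each `A`) and `{ℓ² ∣ A, ℓ³ ∣ B}` (the case `ℓ ∣ A`, `sq_dvd_and_cube_dvd`), summed with
`Σ_{ℓ > Y} ℓ⁻⁵ ≤ 1/(4Y⁴)`. [folklore] -/
theorem card_tail_le {X : ℕ} (hX : 1 ≤ X) {Y : ℕ} (hY : 4 ≤ Y) :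
    (((heightFamilyBelow X).filter (fun AB : ℤ × ℤ ↦ ∃ ℓ : ℕ, ℓ.Prime ∧ Y < ℓ ∧
        (ℓ : ℤ) ^ 5 ∣ 4 * AB.1 ^ 3 + 27 * AB.2 ^ 2)).card : ℝ) ≤
      3 / (Y : ℝ) ^ 4 * (R₁ X * R₂ X) +
        ⌊(2 * (X : ℝ)) ^ (1 / 5 : ℝ)⌋₊ * (10 * R₁ X + 6 * R₂ X + 5) := by
  set L := ⌊(2 * (X : ℝ)) ^ (1 / 5 : ℝ)⌋₊ with hL
  set T1 : ℕ → Finset (ℤ × ℤ) := fun ℓ ↦ (box X).filter (fun AB : ℤ × ℤ ↦ ¬ (ℓ : ℤ) ∣ AB.1 ∧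
      (ℓ : ℤ) ^ 5 ∣ 4 * AB.1 ^ 3 + 27 * AB.2 ^ 2) with hT1
  set T2 : ℕ → Finset (ℤ × ℤ) := fun ℓ ↦ (box X).filter (fun AB : ℤ × ℤ ↦ (ℓ : ℤ) ^ 2 ∣ AB.1 ∧
      (ℓ : ℤ) ^ 3 ∣ AB.2) with hT2
  have hsub : (heightFamilyBelow X).filter (fun AB : ℤ × ℤ ↦ ∃ ℓ : ℕ, ℓ.Prime ∧ Y < ℓ ∧
        (ℓ : ℤ) ^ 5 ∣ 4 * AB.1 ^ 3 + 27 * AB.2 ^ 2) ⊆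
      ((Finset.Ioc Y L).filter Nat.Prime).biUnion (fun ℓ ↦ T1 ℓ ∪ T2 ℓ) := by
    intro AB hAB
    rw [Finset.mem_filter, heightFamilyBelow_eq, Finset.mem_filter] at hAB
    obtain ⟨⟨hbox, hfam⟩, ℓ, hℓ, hYℓ, hdvd⟩ := hAB
    have h5 : 5 ≤ ℓ := by omega
    rw [Finset.mem_biUnion]
    refine ⟨ℓ, Finset.mem_filter.mpr ⟨Finset.mem_Ioc.mpr ⟨hYℓ, ?_⟩, hℓ⟩, ?_⟩
    · exact le_floor_of_pow_five_dvd hbox hfam.1 hdvd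
    · rw [Finset.mem_union]
      by_cases hA : (ℓ : ℤ) ∣ AB.1
      · right
        obtain ⟨h2, h3⟩ := sq_dvd_and_cube_dvd hℓ h5 hA hdvd
        exact Finset.mem_filter.mpr ⟨hbox, h2, h3⟩
      · left
        exact Finset.mem_filter.mpr ⟨hbox, hA, hdvd⟩
  have hR₁ := R₁_pos hX
  have hR₂ := R₂_pos hX
  have hper : ∀ ℓ ∈ (Finset.Ioc Y L).filter Nat.Prime,
      (((T1 ℓ ∪ T2 ℓ).card : ℕ) : ℝ) ≤
        12 * (R₁ X * R₂ X) * (1 / (ℓ : ℝ) ^ 5) + (10 * R₁ X + 6 * R₂ X + 5) := by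
    intro ℓ hℓ
    rw [Finset.mem_filter, Finset.mem_Ioc] at hℓ
    obtain ⟨⟨hYℓ, -⟩, hℓp⟩ := hℓ
    have h5 : 5 ≤ ℓ := by omega
    have hl1 : (1 : ℝ) ≤ ℓ := by exact_mod_cast hℓp.one_lt.le
    have b1 : ((T1 ℓ).card : ℝ) ≤ (2 * R₁ X + 1) * (2 * (2 * R₂ X / (ℓ : ℝ) ^ 5 + 2)) :=
      card_filter_prod_not_dvd_and_pow_dvd_disc_le hℓp h5 (by norm_num) hR₁ hR₂
    have b2 : ((T2 ℓ).card : ℝ) ≤ (2 * (R₁ X / (ℓ : ℝ) ^ 2) + 1) * (2 * (R₂ X / (ℓ : ℝ) ^ 3) + 1) := by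
      have hl' : (0 : ℤ) < ℓ := by exact_mod_cast hℓp.pos
      have h := card_box_filter_dvd_dvd_le hX (m₁ := (ℓ : ℤ) ^ 2) (m₂ := (ℓ : ℤ) ^ 3)
        (pow_pos hl' 2) (pow_pos hl' 3)
      push_cast at h
      exact h
    calc (((T1 ℓ ∪ T2 ℓ).card : ℕ) : ℝ) ≤ ((T1 ℓ).card : ℝ) + (T2 ℓ).card := by
          exact_mod_cast Finset.card_union_le _ _
      _ ≤ (2 * R₁ X + 1) * (2 * (2 * R₂ X / (ℓ : ℝ) ^ 5 + 2)) +
            (2 * (R₁ X / (ℓ : ℝ) ^ 2) + 1) * (2 * (R₂ X / (ℓ : ℝ) ^ 3) + 1) := add_le_add b1 b2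
      _ ≤ 12 * (R₁ X * R₂ X) * (1 / (ℓ : ℝ) ^ 5) + (10 * R₁ X + 6 * R₂ X + 5) :=
          per_prime_bound hl1 hR₁.le hR₂.le
  have hC : 0 ≤ 10 * R₁ X + 6 * R₂ X + 5 := by linarith
  have h12 : 0 ≤ 12 * (R₁ X * R₂ X) := by positivity
  have hnonneg : ∀ n ∈ Finset.Ioc Y L,
      0 ≤ 12 * (R₁ X * R₂ X) * (1 / (n : ℝ) ^ 5) + (10 * R₁ X + 6 * R₂ X + 5) := by
    intro n _
    exact add_nonneg (mul_nonneg h12 (by positivity)) hC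
  have hY1 : 1 ≤ Y := by omega
  have hY0 : (0 : ℝ) < Y := by exact_mod_cast hY1
  calc (((heightFamilyBelow X).filter (fun AB : ℤ × ℤ ↦ ∃ ℓ : ℕ, ℓ.Prime ∧ Y < ℓ ∧
          (ℓ : ℤ) ^ 5 ∣ 4 * AB.1 ^ 3 + 27 * AB.2 ^ 2)).card : ℝ)
      ≤ (((Finset.Ioc Y L).filter Nat.Prime).biUnion (fun ℓ ↦ T1 ℓ ∪ T2 ℓ)).card := by
        exact_mod_cast Finset.card_le_card hsub
    _ ≤ ∑ ℓ ∈ (Finset.Ioc Y L).filter Nat.Prime, (((T1 ℓ ∪ T2 ℓ).card : ℕ) : ℝ) := by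
        exact_mod_cast Finset.card_biUnion_le
    _ ≤ ∑ ℓ ∈ (Finset.Ioc Y L).filter Nat.Prime,
          (12 * (R₁ X * R₂ X) * (1 / (ℓ : ℝ) ^ 5) + (10 * R₁ X + 6 * R₂ X + 5)) :=
        Finset.sum_le_sum hper
    _ ≤ ∑ n ∈ Finset.Ioc Y L,
          (12 * (R₁ X * R₂ X) * (1 / (n : ℝ) ^ 5) + (10 * R₁ X + 6 * R₂ X + 5)) :=
        Finset.sum_le_sum_of_subset_of_nonneg (Finset.filter_subset _ _)
          (fun n hn _ ↦ hnonneg n hn)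
    _ = 12 * (R₁ X * R₂ X) * ∑ n ∈ Finset.Ioc Y L, 1 / (n : ℝ) ^ 5 +
          ((Finset.Ioc Y L).card : ℝ) * (10 * R₁ X + 6 * R₂ X + 5) := by
        rw [Finset.sum_add_distrib, Finset.mul_sum, Finset.sum_const, nsmul_eq_mul]
    _ ≤ 12 * (R₁ X * R₂ X) * (1 / (4 * (Y : ℝ) ^ 4)) + (L : ℝ) * (10 * R₁ X + 6 * R₂ X + 5) := by
        refine add_le_add (mul_le_mul_of_nonneg_left (sum_Ioc_inv_pow_five_le hY1 L) h12)
          (mul_le_mul_of_nonneg_right ?_ hC)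
        rw [Nat.card_Ioc]
        exact_mod_cast Nat.sub_le L Y
    _ = 3 / (Y : ℝ) ^ 4 * (R₁ X * R₂ X) + L * (10 * R₁ X + 6 * R₂ X + 5) := by
        field_simp
        ring

/-- The lower-order term of the tail count is `≤ 42 X^{7/10}` for `X ≥ 1`. [folklore] -/
theorem tailErr_le {X : ℕ} (hX : 1 ≤ X) :
    (⌊(2 * (X : ℝ)) ^ (1 / 5 : ℝ)⌋₊ : ℝ) * (10 * R₁ X + 6 * R₂ X + 5) ≤
      42 * (X : ℝ) ^ (7 / 10 : ℝ) := by
  have hX1 : (1 : ℝ) ≤ X := by exact_mod_cast hX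
  have hX0 : (0 : ℝ) < X := by linarith
  have h25 : (2 : ℝ) ^ (1 / 5 : ℝ) ≤ 2 := by
    calc (2 : ℝ) ^ (1 / 5 : ℝ) ≤ (2 : ℝ) ^ (1 : ℝ) :=
          Real.rpow_le_rpow_of_exponent_le (by norm_num) (by norm_num)
      _ = 2 := Real.rpow_one 2
  have hL : (⌊(2 * (X : ℝ)) ^ (1 / 5 : ℝ)⌋₊ : ℝ) ≤ 2 * (X : ℝ) ^ (1 / 5 : ℝ) := by
    calc (⌊(2 * (X : ℝ)) ^ (1 / 5 : ℝ)⌋₊ : ℝ) ≤ (2 * (X : ℝ)) ^ (1 / 5 : ℝ) :=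
          Nat.floor_le (by positivity)
      _ = (2 : ℝ) ^ (1 / 5 : ℝ) * (X : ℝ) ^ (1 / 5 : ℝ) := Real.mul_rpow (by norm_num) hX0.le
      _ ≤ 2 * (X : ℝ) ^ (1 / 5 : ℝ) := mul_le_mul_of_nonneg_right h25 (by positivity)
  have h1 : R₁ X ≤ (X : ℝ) ^ (1 / 2 : ℝ) := by
    calc R₁ X ≤ 1 * (X : ℝ) ^ (1 / 3 : ℝ) := R₁_le
      _ = (X : ℝ) ^ (1 / 3 : ℝ) := one_mul _
      _ ≤ (X : ℝ) ^ (1 / 2 : ℝ) := Real.rpow_le_rpow_of_exponent_le hX1 (by norm_num)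
  have h2 : R₂ X ≤ (X : ℝ) ^ (1 / 2 : ℝ) := by have := R₂_le (X := X); linarith
  have h3 : (1 : ℝ) ≤ (X : ℝ) ^ (1 / 2 : ℝ) := Real.one_le_rpow hX1 (by norm_num)
  have hsum : 10 * R₁ X + 6 * R₂ X + 5 ≤ 21 * (X : ℝ) ^ (1 / 2 : ℝ) := by linarith
  have hprod : (X : ℝ) ^ (1 / 5 : ℝ) * (X : ℝ) ^ (1 / 2 : ℝ) = (X : ℝ) ^ (7 / 10 : ℝ) := by
    rw [← Real.rpow_add hX0]; norm_num
  have hnn : 0 ≤ 10 * R₁ X + 6 * R₂ X + 5 := by linarith [R₁_nonneg X, R₂_nonneg X]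
  calc (⌊(2 * (X : ℝ)) ^ (1 / 5 : ℝ)⌋₊ : ℝ) * (10 * R₁ X + 6 * R₂ X + 5)
      ≤ (2 * (X : ℝ) ^ (1 / 5 : ℝ)) * (21 * (X : ℝ) ^ (1 / 2 : ℝ)) :=
        mul_le_mul hL hsum hnn (by positivity)
    _ = 42 * (X : ℝ) ^ (7 / 10 : ℝ) := by rw [← hprod]; ring

/-- The lower-order term of the tail count is `o(X^{5/6})`. [folklore] -/
theorem tendsto_tailErr_div :
    Tendsto (fun X : ℕ ↦ (⌊(2 * (X : ℝ)) ^ (1 / 5 : ℝ)⌋₊ : ℝ) * (10 * R₁ X + 6 * R₂ X + 5) /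
      (X : ℝ) ^ (5 / 6 : ℝ)) atTop (𝓝 0) :=
  tendsto_div_rpow_fiveSixths_of_le (a := 7 / 10) (C := 42) (by norm_num)
    (fun X ↦ mul_nonneg (Nat.cast_nonneg _) (by linarith [R₁_nonneg X, R₂_nonneg X]))
    (fun X hX ↦ tailErr_le hX)

/-- **The tail has upper density `≤ 3/(2Y⁴)`**: eventually at most `(3/(2Y⁴) + η)·#{H < X}` curves of
height `< X` have `ℓ⁵ ∣ 4A³ + 27B²` for some prime `ℓ > Y` (`Y ≥ 4`). [folklore] -/
theorem eventually_card_tail_le {Y : ℕ} (hY : 4 ≤ Y) :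
    ∀ η : ℝ, 0 < η → ∀ᶠ X : ℕ in atTop,
      (((heightFamilyBelow X).filter (fun AB : ℤ × ℤ ↦ ∃ ℓ : ℕ, ℓ.Prime ∧ Y < ℓ ∧
        (ℓ : ℤ) ^ 5 ∣ 4 * AB.1 ^ 3 + 27 * AB.2 ^ 2)).card : ℝ) ≤
        (3 / (Y : ℝ) ^ 4 / 2 + η) * (heightFamilyBelow X).card :=
  eventually_le_of_box_bound (by positivity) tendsto_tailErr_div (fun _ hX ↦ card_tail_le hX hY)

/-! ### §G The two pieces with `ℓ ∣ A` at a fixed prime -/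

/-- **`{ℓ³ ∣ A, ℓ⁵ ∣ B}` has upper density `≤ 2/ℓ⁸`.** [folklore] -/
theorem eventually_card_cube_dvd_le {ℓ : ℕ} (hℓ : ℓ.Prime) :
    ∀ η : ℝ, 0 < η → ∀ᶠ X : ℕ in atTop,
      (((heightFamilyBelow X).filter (fun AB : ℤ × ℤ ↦
          (ℓ : ℤ) ^ 3 ∣ AB.1 ∧ (ℓ : ℤ) ^ 5 ∣ AB.2)).card : ℝ) ≤
        (4 / (ℓ : ℝ) ^ 8 / 2 + η) * (heightFamilyBelow X).card := by
  have hl : (0 : ℝ) < ℓ := by exact_mod_cast hℓ.pos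
  refine eventually_le_of_box_bound (by positivity)
    (E := fun X ↦ 2 * (R₁ X / (ℓ : ℝ) ^ 3) + 2 * (R₂ X / (ℓ : ℝ) ^ 5) + 1) ?_ ?_
  · have h := ((tendsto_R₁_div.const_mul (2 / (ℓ : ℝ) ^ 3)).add
      (tendsto_R₂_div.const_mul (2 / (ℓ : ℝ) ^ 5))).add tendsto_one_div
    rw [mul_zero, mul_zero, add_zero, add_zero] at h
    refine h.congr fun X ↦ ?_
    ring
  · intro X hX
    have hsub : (heightFamilyBelow X).filter (fun AB : ℤ × ℤ ↦
          (ℓ : ℤ) ^ 3 ∣ AB.1 ∧ (ℓ : ℤ) ^ 5 ∣ AB.2) ⊆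
        (box X).filter (fun AB : ℤ × ℤ ↦ (ℓ : ℤ) ^ 3 ∣ AB.1 ∧ (ℓ : ℤ) ^ 5 ∣ AB.2) := by
      intro AB hAB
      rw [Finset.mem_filter, heightFamilyBelow_eq, Finset.mem_filter] at hAB
      exact Finset.mem_filter.mpr ⟨hAB.1.1, hAB.2⟩
    have hl' : (0 : ℤ) < ℓ := by exact_mod_cast hℓ.pos
    have h := card_box_filter_dvd_dvd_le hX (m₁ := (ℓ : ℤ) ^ 3) (m₂ := (ℓ : ℤ) ^ 5)
      (pow_pos hl' 3) (pow_pos hl' 5)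
    push_cast at h
    calc (((heightFamilyBelow X).filter (fun AB : ℤ × ℤ ↦
            (ℓ : ℤ) ^ 3 ∣ AB.1 ∧ (ℓ : ℤ) ^ 5 ∣ AB.2)).card : ℝ)
        ≤ ((box X).filter (fun AB : ℤ × ℤ ↦ (ℓ : ℤ) ^ 3 ∣ AB.1 ∧ (ℓ : ℤ) ^ 5 ∣ AB.2)).card := by
          exact_mod_cast Finset.card_le_card hsub
      _ ≤ (2 * (R₁ X / (ℓ : ℝ) ^ 3) + 1) * (2 * (R₂ X / (ℓ : ℝ) ^ 5) + 1) := h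
      _ = 4 / (ℓ : ℝ) ^ 8 * (R₁ X * R₂ X) +
            (2 * (R₁ X / (ℓ : ℝ) ^ 3) + 2 * (R₂ X / (ℓ : ℝ) ^ 5) + 1) := by
          field_simp
          ring

/-- **`{A = ℓ²a, B = ℓ³b, ℓ ∤ a, ℓ⁴ ∣ 4a³ + 27b²}` has upper density `≤ 4/ℓ⁹`** (`ℓ ≥ 5` prime).
[folklore] -/
theorem eventually_card_rescaled_le {ℓ : ℕ} (hℓ : ℓ.Prime) (h5 : 5 ≤ ℓ) :
    ∀ η : ℝ, 0 < η → ∀ᶠ X : ℕ in atTop,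
      (((heightFamilyBelow X).filter (fun AB : ℤ × ℤ ↦ ∃ a b : ℤ, AB.1 = (ℓ : ℤ) ^ 2 * a ∧
          AB.2 = (ℓ : ℤ) ^ 3 * b ∧ ¬ (ℓ : ℤ) ∣ a ∧ (ℓ : ℤ) ^ 4 ∣ 4 * a ^ 3 + 27 * b ^ 2)).card : ℝ) ≤
        (8 / (ℓ : ℝ) ^ 9 / 2 + η) * (heightFamilyBelow X).card := by
  have hl : (0 : ℝ) < ℓ := by exact_mod_cast hℓ.pos
  refine eventually_le_of_box_bound (by positivity)
    (E := fun X ↦ 8 * (R₁ X / (ℓ : ℝ) ^ 2) + 4 * (R₂ X / (ℓ : ℝ) ^ 7) + 4) ?_ ?_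
  · have h := ((tendsto_R₁_div.const_mul (8 / (ℓ : ℝ) ^ 2)).add
      (tendsto_R₂_div.const_mul (4 / (ℓ : ℝ) ^ 7))).add (tendsto_one_div.const_mul 4)
    rw [mul_zero, mul_zero, mul_zero, add_zero, add_zero] at h
    refine h.congr fun X ↦ ?_
    ring
  · intro X hX
    have hsub : (heightFamilyBelow X).filter (fun AB : ℤ × ℤ ↦ ∃ a b : ℤ, AB.1 = (ℓ : ℤ) ^ 2 * a ∧
          AB.2 = (ℓ : ℤ) ^ 3 * b ∧ ¬ (ℓ : ℤ) ∣ a ∧ (ℓ : ℤ) ^ 4 ∣ 4 * a ^ 3 + 27 * b ^ 2) ⊆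
        (box X).filter (fun AB : ℤ × ℤ ↦ ∃ a b : ℤ, AB.1 = (ℓ : ℤ) ^ 2 * a ∧
          AB.2 = (ℓ : ℤ) ^ 3 * b ∧ ¬ (ℓ : ℤ) ∣ a ∧ (ℓ : ℤ) ^ 4 ∣ 4 * a ^ 3 + 27 * b ^ 2) := by
      intro AB hAB
      rw [Finset.mem_filter, heightFamilyBelow_eq, Finset.mem_filter] at hAB
      exact Finset.mem_filter.mpr ⟨hAB.1.1, hAB.2⟩
    have h := card_box_filter_rescaled_le hX hℓ h5
    calc (((heightFamilyBelow X).filter (fun AB : ℤ × ℤ ↦ ∃ a b : ℤ, AB.1 = (ℓ : ℤ) ^ 2 * a ∧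
            AB.2 = (ℓ : ℤ) ^ 3 * b ∧ ¬ (ℓ : ℤ) ∣ a ∧ (ℓ : ℤ) ^ 4 ∣ 4 * a ^ 3 + 27 * b ^ 2)).card : ℝ)
        ≤ ((box X).filter (fun AB : ℤ × ℤ ↦ ∃ a b : ℤ, AB.1 = (ℓ : ℤ) ^ 2 * a ∧
            AB.2 = (ℓ : ℤ) ^ 3 * b ∧ ¬ (ℓ : ℤ) ∣ a ∧ (ℓ : ℤ) ^ 4 ∣ 4 * a ^ 3 + 27 * b ^ 2)).card := by
          exact_mod_cast Finset.card_le_card hsub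
      _ ≤ (2 * (R₁ X / (ℓ : ℝ) ^ 2) + 1) * (2 * (2 * (R₂ X / (ℓ : ℝ) ^ 3) / (ℓ : ℝ) ^ 4 + 2)) := h
      _ = 8 / (ℓ : ℝ) ^ 9 * (R₁ X * R₂ X) +
            (8 * (R₁ X / (ℓ : ℝ) ^ 2) + 4 * (R₂ X / (ℓ : ℝ) ^ 7) + 4) := by
          field_simp
          ring


/-! ### §H Assembly -/

/-- **At a fixed prime `q ≥ 5`: the curves `E_{A,B}` with `q ∣ 4A³ + 27B²` and `5 ∣ ord_q(4A³ + 27B²)`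
have upper height density at most `(q-1)/(q⁶(1 - q⁻¹⁰)) + 2/q⁸ + 4/q⁹`** (the three pieces of
`trichotomy`: the exact density of `{q ∤ A, q⁵ ∣ 4A³+27B²}` and the two box bounds).
[cite: BhargavaSkinnerZhang2014, Lemma 19 (proof)] -/
theorem eventually_card_prime_le {q : ℕ} (hq : q.Prime) (h5 : 5 ≤ q) :
    ∀ η : ℝ, 0 < η → ∀ᶠ X : ℕ in atTop,
      (((heightFamilyBelow X).filter (fun AB : ℤ × ℤ ↦ (q : ℤ) ∣ 4 * AB.1 ^ 3 + 27 * AB.2 ^ 2 ∧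
          5 ∣ padicValInt q (4 * AB.1 ^ 3 + 27 * AB.2 ^ 2))).card : ℝ) ≤
        (((q : ℝ) - 1) / (q : ℝ) ^ 6 / (1 - 1 / (q : ℝ) ^ 10) + 2 / (q : ℝ) ^ 8 + 4 / (q : ℝ) ^ 9 + η) *
          (heightFamilyBelow X).card := by
  intro η hη
  haveI := Fact.mk hq
  have hM : HasHeightDensity
      (fun AB : ℤ × ℤ ↦ ¬ (q : ℤ) ∣ AB.1 ∧ (q : ℤ) ^ 5 ∣ 4 * AB.1 ^ 3 + 27 * AB.2 ^ 2)
      (((q : ℝ) - 1) / (q : ℝ) ^ 6 / (1 - 1 / (q : ℝ) ^ 10)) :=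
    hasHeightDensity_not_dvd_and_pow_dvd_disc (p := q) h5 (k := 3) (by norm_num)
  have h1 := eventually_card_filter_le_of_hasHeightDensity hM (η / 3) (by positivity)
  have h2 := eventually_card_cube_dvd_le hq (η / 3) (by positivity)
  have h3 := eventually_card_rescaled_le hq h5 (η / 3) (by positivity)
  filter_upwards [h1, h2, h3] with X hX1 hX2 hX3
  set sM := (heightFamilyBelow X).filter
      (fun AB : ℤ × ℤ ↦ ¬ (q : ℤ) ∣ AB.1 ∧ (q : ℤ) ^ 5 ∣ 4 * AB.1 ^ 3 + 27 * AB.2 ^ 2) with hsM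
  set s1 := (heightFamilyBelow X).filter
      (fun AB : ℤ × ℤ ↦ (q : ℤ) ^ 3 ∣ AB.1 ∧ (q : ℤ) ^ 5 ∣ AB.2) with hs1
  set s2 := (heightFamilyBelow X).filter (fun AB : ℤ × ℤ ↦ ∃ a b : ℤ, AB.1 = (q : ℤ) ^ 2 * a ∧
      AB.2 = (q : ℤ) ^ 3 * b ∧ ¬ (q : ℤ) ∣ a ∧ (q : ℤ) ^ 4 ∣ 4 * a ^ 3 + 27 * b ^ 2) with hs2
  have hsub : (heightFamilyBelow X).filter (fun AB : ℤ × ℤ ↦ (q : ℤ) ∣ 4 * AB.1 ^ 3 + 27 * AB.2 ^ 2 ∧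
        5 ∣ padicValInt q (4 * AB.1 ^ 3 + 27 * AB.2 ^ 2)) ⊆ sM ∪ s1 ∪ s2 := by
    intro AB hAB
    rw [Finset.mem_filter] at hAB
    obtain ⟨hmem, hdvd, hord⟩ := hAB
    have hfam := ((mem_heightFamilyBelow_iff AB X).mp hmem).1
    rcases trichotomy hq h5 hfam.1 hdvd hord with hM' | hS1 | hS2
    · exact Finset.mem_union_left _ (Finset.mem_union_left _ (Finset.mem_filter.mpr ⟨hmem, hM'⟩))
    · exact Finset.mem_union_left _ (Finset.mem_union_right _ (Finset.mem_filter.mpr ⟨hmem, hS1⟩))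
    · exact Finset.mem_union_right _ (Finset.mem_filter.mpr ⟨hmem, hS2⟩)
  have hc : ((heightFamilyBelow X).filter (fun AB : ℤ × ℤ ↦ (q : ℤ) ∣ 4 * AB.1 ^ 3 + 27 * AB.2 ^ 2 ∧
        5 ∣ padicValInt q (4 * AB.1 ^ 3 + 27 * AB.2 ^ 2))).card ≤ sM.card + s1.card + s2.card :=
    by
    have u0 := Finset.card_le_card hsub
    have u1 := Finset.card_union_le (sM ∪ s1) s2
    have u2 := Finset.card_union_le sM s1
    omega
  have hc' : (((heightFamilyBelow X).filter (fun AB : ℤ × ℤ ↦ (q : ℤ) ∣ 4 * AB.1 ^ 3 + 27 * AB.2 ^ 2 ∧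
        5 ∣ padicValInt q (4 * AB.1 ^ 3 + 27 * AB.2 ^ 2))).card : ℝ) ≤
      (sM.card : ℝ) + s1.card + s2.card := by exact_mod_cast hc
  have e2 : (4 : ℝ) / (q : ℝ) ^ 8 / 2 = 2 / (q : ℝ) ^ 8 := by ring
  have e3 : (8 : ℝ) / (q : ℝ) ^ 9 / 2 = 4 / (q : ℝ) ^ 9 := by ring
  rw [e2] at hX2
  rw [e3] at hX3
  calc (((heightFamilyBelow X).filter (fun AB : ℤ × ℤ ↦ (q : ℤ) ∣ 4 * AB.1 ^ 3 + 27 * AB.2 ^ 2 ∧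
          5 ∣ padicValInt q (4 * AB.1 ^ 3 + 27 * AB.2 ^ 2))).card : ℝ)
      ≤ (sM.card : ℝ) + s1.card + s2.card := hc'
    _ ≤ (((q : ℝ) - 1) / (q : ℝ) ^ 6 / (1 - 1 / (q : ℝ) ^ 10) + η / 3) * (heightFamilyBelow X).card +
          (2 / (q : ℝ) ^ 8 + η / 3) * (heightFamilyBelow X).card +
          (4 / (q : ℝ) ^ 9 + η / 3) * (heightFamilyBelow X).card := add_le_add (add_le_add hX1 hX2) hX3
    _ = (((q : ℝ) - 1) / (q : ℝ) ^ 6 / (1 - 1 / (q : ℝ) ^ 10) + 2 / (q : ℝ) ^ 8 + 4 / (q : ℝ) ^ 9 + η) *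
          (heightFamilyBelow X).card := by ring

/-- The primes `ℓ ≤ 40` with `ℓ ≡ ±1 (mod 5)` are `11, 19, 29, 31`. [folklore] -/
theorem eq_of_prime_pm_one_mod_five_le_forty {ℓ : ℕ} (hℓ : ℓ.Prime) (hmod : ℓ % 5 = 1 ∨ ℓ % 5 = 4)
    (h40 : ℓ ≤ 40) : ℓ = 11 ∨ ℓ = 19 ∨ ℓ = 29 ∨ ℓ = 31 := by
  rcases hmod with h | h <;> interval_cases ℓ <;> first | omega | exact absurd hℓ (by norm_num)

end BSZMuDiff

open BSZMuDiff HeightCount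

/-- **Bhargava–Skinner–Zhang, display (2): `μ(S₁'(5)) - μ(S₁(5)) ≤ 10⁻⁵` — proved, in the form:
the curves `E_{A,B}` for which some prime `ℓ ≡ ±1 (mod 5)` has `ℓ ∣ Δ(A,B)` and `5 ∣ ord_ℓ Δ(A,B)`
(the condition defining `S₁(p)` inside `S₁'(p)` in §3.1 of the source, negated; `ord_ℓ Δ(A,B) =
ord_ℓ(4A³ + 27B²)` for odd `ℓ` as `Δ = -16(4A³ + 27B²)`) have upper height density at most `10⁻⁵`.**
Precisely: for every `η > 0`, for all large `X`, at most `(10⁻⁵ + η)·#{E_{A,B} : H < X}` curves of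
naive height `< X` have this property. The source obtains (5) from Lemma 19
(`μ(S₁(5)) ≥ μ(S₁'(5))·∏_{ℓ ≡ ±1 (5)} (1-ℓ⁻¹⁰)⁻¹(1 - (ℓ-1)²/(ℓ²(ℓ⁵-1)) - ℓ⁻⁵) = .7917957…`), i.e. from
the product formula for densities of large families defined by congruence conditions at infinitely
many primes ([BS2]). The proof given here is a genuinely shorter road to the same display, by a union
bound instead of the product formula: `ℓ ∣ Δ` with `5 ∣ ord_ℓ Δ` forces `ℓ⁵ ∣ 4A³ + 27B²`; at each of the
primes `ℓ = 11, 19, 29, 31` the set has upper density `≤ (ℓ-1)/(ℓ⁶(1-ℓ⁻¹⁰)) + 2/ℓ⁸ + 4/ℓ⁹`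
(`BSZMuDiff.eventually_card_prime_le`: the exact one-prime density `(ℓ-1)/(ℓ⁶(1-ℓ⁻¹⁰))` of
`{ℓ ∤ A, ℓ⁵ ∣ 4A³+27B²}` — the sum over `k ≥ 5` of the printed measures `(ℓ-1)²/ℓ^{k+2}` — plus the two
pieces with `ℓ ∣ A`, which the source bounds by the measure `ℓ⁻⁵` of `{ℓ² ∣ A, ℓ³ ∣ B}` and which are
here `{ℓ³ ∣ A, ℓ⁵ ∣ B}` and `{ℓ² ‖ A, ℓ³ ‖ B, ℓ¹⁰ ∣ Δ}`), and the primes `ℓ > 40` together contribute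
upper density `≤ 3/(2·40⁴)` (`BSZMuDiff.eventually_card_tail_le`: only two classes of `B` modulo `ℓ⁵`
for each `A` with `ℓ ∤ A`, `ℓ ≤ (2X)^{1/5}`, and `Σ_{ℓ > Y} ℓ⁻⁵ ≤ 1/(4Y⁴)`); in total
`6.71·10⁻⁶ ≤ 10⁻⁵`. (With the source's own route the bound is `μ(S₁'(5))·(1 - .9999877) ≈ 9.7·10⁻⁶`.)
This is hypothesis `hν` of the assembly
`Literature.NumberTheory.EllipticCurves.heightDensityGE_satisfiesBSDRankLeOne_of_pieces`
(`LeadingTermBSZAssemblyProofs`), see `bsz_mu_diff_inter_le`.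
[cite: BhargavaSkinnerZhang2014, Lemma 19 and display (2)] -/
theorem bsz_mu_diff :
    ∀ η : ℝ, 0 < η → ∀ᶠ X : ℕ in atTop,
      (((heightFamilyBelow X).filter (fun AB : ℤ × ℤ ↦ ∃ ℓ : ℕ, ℓ.Prime ∧ (ℓ % 5 = 1 ∨ ℓ % 5 = 4) ∧
          (ℓ : ℤ) ∣ 4 * AB.1 ^ 3 + 27 * AB.2 ^ 2 ∧
          5 ∣ padicValInt ℓ (4 * AB.1 ^ 3 + 27 * AB.2 ^ 2))).card : ℝ) ≤
        (1 / 10 ^ 5 + η) * (heightFamilyBelow X).card := by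
  intro η hη
  have e11 := eventually_card_prime_le (q := 11) (by norm_num) (by norm_num) (η / 5) (by positivity)
  have e19 := eventually_card_prime_le (q := 19) (by norm_num) (by norm_num) (η / 5) (by positivity)
  have e29 := eventually_card_prime_le (q := 29) (by norm_num) (by norm_num) (η / 5) (by positivity)
  have e31 := eventually_card_prime_le (q := 31) (by norm_num) (by norm_num) (η / 5) (by positivity)
  have eT := eventually_card_tail_le (Y := 40) (by norm_num) (η / 5) (by positivity)
  filter_upwards [e11, e19, e29, e31, eT] with X h11 h19 h29 h31 hT
  set p11 := (heightFamilyBelow X).filter (fun AB : ℤ × ℤ ↦ ((11 : ℕ) : ℤ) ∣ 4 * AB.1 ^ 3 + 27 * AB.2 ^ 2 ∧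
      5 ∣ padicValInt 11 (4 * AB.1 ^ 3 + 27 * AB.2 ^ 2)) with hp11
  set p19 := (heightFamilyBelow X).filter (fun AB : ℤ × ℤ ↦ ((19 : ℕ) : ℤ) ∣ 4 * AB.1 ^ 3 + 27 * AB.2 ^ 2 ∧
      5 ∣ padicValInt 19 (4 * AB.1 ^ 3 + 27 * AB.2 ^ 2)) with hp19
  set p29 := (heightFamilyBelow X).filter (fun AB : ℤ × ℤ ↦ ((29 : ℕ) : ℤ) ∣ 4 * AB.1 ^ 3 + 27 * AB.2 ^ 2 ∧
      5 ∣ padicValInt 29 (4 * AB.1 ^ 3 + 27 * AB.2 ^ 2)) with hp29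
  set p31 := (heightFamilyBelow X).filter (fun AB : ℤ × ℤ ↦ ((31 : ℕ) : ℤ) ∣ 4 * AB.1 ^ 3 + 27 * AB.2 ^ 2 ∧
      5 ∣ padicValInt 31 (4 * AB.1 ^ 3 + 27 * AB.2 ^ 2)) with hp31
  set tl := (heightFamilyBelow X).filter (fun AB : ℤ × ℤ ↦ ∃ ℓ : ℕ, ℓ.Prime ∧ 40 < ℓ ∧
      (ℓ : ℤ) ^ 5 ∣ 4 * AB.1 ^ 3 + 27 * AB.2 ^ 2) with htl
  have hsub : (heightFamilyBelow X).filter (fun AB : ℤ × ℤ ↦ ∃ ℓ : ℕ, ℓ.Prime ∧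
        (ℓ % 5 = 1 ∨ ℓ % 5 = 4) ∧ (ℓ : ℤ) ∣ 4 * AB.1 ^ 3 + 27 * AB.2 ^ 2 ∧
          5 ∣ padicValInt ℓ (4 * AB.1 ^ 3 + 27 * AB.2 ^ 2)) ⊆ p11 ∪ p19 ∪ p29 ∪ p31 ∪ tl := by
    intro AB hAB
    rw [Finset.mem_filter] at hAB
    obtain ⟨hmem, ℓ, hℓ, hmod, hdvd, hord⟩ := hAB
    simp only [Finset.mem_union]
    rcases le_or_gt ℓ 40 with h40 | h40
    · rcases eq_of_prime_pm_one_mod_five_le_forty hℓ hmod h40 with rfl | rfl | rfl | rfl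
      · exact Or.inl (Or.inl (Or.inl (Or.inl (Finset.mem_filter.mpr ⟨hmem, hdvd, hord⟩))))
      · exact Or.inl (Or.inl (Or.inl (Or.inr (Finset.mem_filter.mpr ⟨hmem, hdvd, hord⟩))))
      · exact Or.inl (Or.inl (Or.inr (Finset.mem_filter.mpr ⟨hmem, hdvd, hord⟩)))
      · exact Or.inl (Or.inr (Finset.mem_filter.mpr ⟨hmem, hdvd, hord⟩))
    · right
      haveI := Fact.mk hℓ
      have hfam := ((mem_heightFamilyBelow_iff AB X).mp hmem).1
      have hv1 : 1 ≤ padicValInt ℓ (4 * AB.1 ^ 3 + 27 * AB.2 ^ 2) := by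
        rcases (padicValInt_dvd_iff (p := ℓ) 1 (4 * AB.1 ^ 3 + 27 * AB.2 ^ 2)).mp
          (by rwa [pow_one]) with h0 | h1
        · exact absurd h0 hfam.1
        · exact h1
      obtain ⟨w, hw⟩ := hord
      have hΔ5 : (ℓ : ℤ) ^ 5 ∣ 4 * AB.1 ^ 3 + 27 * AB.2 ^ 2 :=
        (padicValInt_dvd_iff (p := ℓ) 5 _).mpr (Or.inr (by omega))
      exact Finset.mem_filter.mpr ⟨hmem, ℓ, hℓ, h40, hΔ5⟩
  have hc : ((heightFamilyBelow X).filter (fun AB : ℤ × ℤ ↦ ∃ ℓ : ℕ, ℓ.Prime ∧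
        (ℓ % 5 = 1 ∨ ℓ % 5 = 4) ∧ (ℓ : ℤ) ∣ 4 * AB.1 ^ 3 + 27 * AB.2 ^ 2 ∧
          5 ∣ padicValInt ℓ (4 * AB.1 ^ 3 + 27 * AB.2 ^ 2))).card ≤
      p11.card + p19.card + p29.card + p31.card + tl.card :=
    by
    have u0 := Finset.card_le_card hsub
    have u1 := Finset.card_union_le (p11 ∪ p19 ∪ p29 ∪ p31) tl
    have u2 := Finset.card_union_le (p11 ∪ p19 ∪ p29) p31
    have u3 := Finset.card_union_le (p11 ∪ p19) p29
    have u4 := Finset.card_union_le p11 p19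
    omega
  have hc' : (((heightFamilyBelow X).filter (fun AB : ℤ × ℤ ↦ ∃ ℓ : ℕ, ℓ.Prime ∧
        (ℓ % 5 = 1 ∨ ℓ % 5 = 4) ∧ (ℓ : ℤ) ∣ 4 * AB.1 ^ 3 + 27 * AB.2 ^ 2 ∧
          5 ∣ padicValInt ℓ (4 * AB.1 ^ 3 + 27 * AB.2 ^ 2))).card : ℝ) ≤
      (p11.card : ℝ) + p19.card + p29.card + p31.card + tl.card := by exact_mod_cast hc
  have hN : (0 : ℝ) ≤ (heightFamilyBelow X).card := Nat.cast_nonneg _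
  have hnum : (((11 : ℕ) : ℝ) - 1) / ((11 : ℕ) : ℝ) ^ 6 / (1 - 1 / ((11 : ℕ) : ℝ) ^ 10) +
        2 / ((11 : ℕ) : ℝ) ^ 8 + 4 / ((11 : ℕ) : ℝ) ^ 9 +
      ((((19 : ℕ) : ℝ) - 1) / ((19 : ℕ) : ℝ) ^ 6 / (1 - 1 / ((19 : ℕ) : ℝ) ^ 10) +
        2 / ((19 : ℕ) : ℝ) ^ 8 + 4 / ((19 : ℕ) : ℝ) ^ 9) +
      ((((29 : ℕ) : ℝ) - 1) / ((29 : ℕ) : ℝ) ^ 6 / (1 - 1 / ((29 : ℕ) : ℝ) ^ 10) +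
        2 / ((29 : ℕ) : ℝ) ^ 8 + 4 / ((29 : ℕ) : ℝ) ^ 9) +
      ((((31 : ℕ) : ℝ) - 1) / ((31 : ℕ) : ℝ) ^ 6 / (1 - 1 / ((31 : ℕ) : ℝ) ^ 10) +
        2 / ((31 : ℕ) : ℝ) ^ 8 + 4 / ((31 : ℕ) : ℝ) ^ 9) +
      3 / ((40 : ℕ) : ℝ) ^ 4 / 2 ≤ 1 / 10 ^ 5 := by
    norm_num
  calc (((heightFamilyBelow X).filter (fun AB : ℤ × ℤ ↦ ∃ ℓ : ℕ, ℓ.Prime ∧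
          (ℓ % 5 = 1 ∨ ℓ % 5 = 4) ∧ (ℓ : ℤ) ∣ 4 * AB.1 ^ 3 + 27 * AB.2 ^ 2 ∧
            5 ∣ padicValInt ℓ (4 * AB.1 ^ 3 + 27 * AB.2 ^ 2))).card : ℝ)
      ≤ (p11.card : ℝ) + p19.card + p29.card + p31.card + tl.card := hc'
    _ ≤ ((((11 : ℕ) : ℝ) - 1) / ((11 : ℕ) : ℝ) ^ 6 / (1 - 1 / ((11 : ℕ) : ℝ) ^ 10) +
            2 / ((11 : ℕ) : ℝ) ^ 8 + 4 / ((11 : ℕ) : ℝ) ^ 9 + η / 5) * (heightFamilyBelow X).card +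
        ((((19 : ℕ) : ℝ) - 1) / ((19 : ℕ) : ℝ) ^ 6 / (1 - 1 / ((19 : ℕ) : ℝ) ^ 10) +
            2 / ((19 : ℕ) : ℝ) ^ 8 + 4 / ((19 : ℕ) : ℝ) ^ 9 + η / 5) * (heightFamilyBelow X).card +
        ((((29 : ℕ) : ℝ) - 1) / ((29 : ℕ) : ℝ) ^ 6 / (1 - 1 / ((29 : ℕ) : ℝ) ^ 10) +
            2 / ((29 : ℕ) : ℝ) ^ 8 + 4 / ((29 : ℕ) : ℝ) ^ 9 + η / 5) * (heightFamilyBelow X).card +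
        ((((31 : ℕ) : ℝ) - 1) / ((31 : ℕ) : ℝ) ^ 6 / (1 - 1 / ((31 : ℕ) : ℝ) ^ 10) +
            2 / ((31 : ℕ) : ℝ) ^ 8 + 4 / ((31 : ℕ) : ℝ) ^ 9 + η / 5) * (heightFamilyBelow X).card +
        (3 / ((40 : ℕ) : ℝ) ^ 4 / 2 + η / 5) * (heightFamilyBelow X).card :=
        add_le_add (add_le_add (add_le_add (add_le_add h11 h19) h29) h31) hT
    _ = ((((11 : ℕ) : ℝ) - 1) / ((11 : ℕ) : ℝ) ^ 6 / (1 - 1 / ((11 : ℕ) : ℝ) ^ 10) +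
            2 / ((11 : ℕ) : ℝ) ^ 8 + 4 / ((11 : ℕ) : ℝ) ^ 9 +
          ((((19 : ℕ) : ℝ) - 1) / ((19 : ℕ) : ℝ) ^ 6 / (1 - 1 / ((19 : ℕ) : ℝ) ^ 10) +
            2 / ((19 : ℕ) : ℝ) ^ 8 + 4 / ((19 : ℕ) : ℝ) ^ 9) +
          ((((29 : ℕ) : ℝ) - 1) / ((29 : ℕ) : ℝ) ^ 6 / (1 - 1 / ((29 : ℕ) : ℝ) ^ 10) +
            2 / ((29 : ℕ) : ℝ) ^ 8 + 4 / ((29 : ℕ) : ℝ) ^ 9) +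
          ((((31 : ℕ) : ℝ) - 1) / ((31 : ℕ) : ℝ) ^ 6 / (1 - 1 / ((31 : ℕ) : ℝ) ^ 10) +
            2 / ((31 : ℕ) : ℝ) ^ 8 + 4 / ((31 : ℕ) : ℝ) ^ 9) +
          3 / ((40 : ℕ) : ℝ) ^ 4 / 2 + η) * (heightFamilyBelow X).card := by ring
    _ ≤ (1 / 10 ^ 5 + η) * (heightFamilyBelow X).card :=
        mul_le_mul_of_nonneg_right (by linarith [hnum]) hN

/-- **Hypothesis `hν` of the assembly `heightDensityGE_satisfiesBSDRankLeOne_of_pieces`, discharged**: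
for ANY predicate `T` (there: the source's `S₀(5) ∩ S₁'(5)`), with
`S₁(A,B) :⟺ ∀ primes ℓ ≡ ±1 (mod 5), ℓ ∣ 4A³+27B² → 5 ∤ ord_ℓ(4A³+27B²)` (the condition of §3.1 of the
source defining `S₁(5)` inside `S₁'(5)`), eventually
`#{H < X, T ∧ ¬S₁} ≤ (0.00001 + η)·#{H < X}` (`bsz_mu_diff`).
[cite: BhargavaSkinnerZhang2014, display (2)] -/
theorem bsz_mu_diff_inter_le (T : ℤ × ℤ → Prop) :
    ∀ η : ℝ, 0 < η → ∀ᶠ X : ℕ in atTop,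
      (((heightFamilyBelow X).filter (fun AB : ℤ × ℤ ↦ T AB ∧
          ¬ (∀ ℓ : ℕ, ℓ.Prime → (ℓ % 5 = 1 ∨ ℓ % 5 = 4) → (ℓ : ℤ) ∣ 4 * AB.1 ^ 3 + 27 * AB.2 ^ 2 →
            ¬ 5 ∣ padicValInt ℓ (4 * AB.1 ^ 3 + 27 * AB.2 ^ 2)))).card : ℝ) ≤
        (0.00001 + η) * (heightFamilyBelow X).card := by
  intro η hη
  filter_upwards [bsz_mu_diff η hη] with X hX
  have hsub : (heightFamilyBelow X).filter (fun AB : ℤ × ℤ ↦ T AB ∧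
        ¬ (∀ ℓ : ℕ, ℓ.Prime → (ℓ % 5 = 1 ∨ ℓ % 5 = 4) → (ℓ : ℤ) ∣ 4 * AB.1 ^ 3 + 27 * AB.2 ^ 2 →
          ¬ 5 ∣ padicValInt ℓ (4 * AB.1 ^ 3 + 27 * AB.2 ^ 2))) ⊆
      (heightFamilyBelow X).filter (fun AB : ℤ × ℤ ↦ ∃ ℓ : ℕ, ℓ.Prime ∧ (ℓ % 5 = 1 ∨ ℓ % 5 = 4) ∧
          (ℓ : ℤ) ∣ 4 * AB.1 ^ 3 + 27 * AB.2 ^ 2 ∧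
          5 ∣ padicValInt ℓ (4 * AB.1 ^ 3 + 27 * AB.2 ^ 2)) := by
    intro AB hAB
    rw [Finset.mem_filter] at hAB ⊢
    obtain ⟨hmem, -, hnot⟩ := hAB
    push Not at hnot
    exact ⟨hmem, hnot⟩
  have h := Finset.card_le_card hsub
  have h' : (((heightFamilyBelow X).filter (fun AB : ℤ × ℤ ↦ T AB ∧
        ¬ (∀ ℓ : ℕ, ℓ.Prime → (ℓ % 5 = 1 ∨ ℓ % 5 = 4) → (ℓ : ℤ) ∣ 4 * AB.1 ^ 3 + 27 * AB.2 ^ 2 →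
          ¬ 5 ∣ padicValInt ℓ (4 * AB.1 ^ 3 + 27 * AB.2 ^ 2)))).card : ℝ) ≤
      (((heightFamilyBelow X).filter (fun AB : ℤ × ℤ ↦ ∃ ℓ : ℕ, ℓ.Prime ∧ (ℓ % 5 = 1 ∨ ℓ % 5 = 4) ∧
          (ℓ : ℤ) ∣ 4 * AB.1 ^ 3 + 27 * AB.2 ^ 2 ∧
          5 ∣ padicValInt ℓ (4 * AB.1 ^ 3 + 27 * AB.2 ^ 2))).card : ℝ) := by exact_mod_cast h
  have e : (0.00001 : ℝ) = 1 / 10 ^ 5 := by norm_num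
  rw [e]
  exact h'.trans hX


end Literature.NumberTheory.EllipticCurves
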